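import Literature.NumberTheory.LFunctions.ZetaCertifiedEvaluationBall
import Literature.NumberTheory.LFunctions.ZetaCertifiedTablesFast2
import Literature.NumberTheory.LFunctions.MertensConjectureDisproofAssembly
import Literature.NumberTheory.LFunctions.MertensCertificate
import HarnessLib

/-!
# The certified computation behind `limsup M(x)x^{-1/2} ≥ 1.6383` (Best–Trudgian 2015, Thm. 1), II: the tiered checker at height 5000

Topic `Literature/NumberTheory/LFunctions`. D. G. Best and T. S. Trudgian, *Linear relations of
zeroes of the zeta-function*, Math. Comp. 84 (2015) 2047–2058 [BestTrudgian2015], Theorem 1: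
`limsup_{x→∞} M(x)x^{-1/2} ≥ 1.6383`, `liminf_{x→∞} M(x)x^{-1/2} ≤ -1.6383`. As in
`MertensCertificateBT.lean` (the single-tier checker at height `2516`, whose `|y| ≤ 2^5016`
turned out to be too small for the constant `1.6383`), the inequalities are certified by the
route of the tree's Odlyzko–te Riele computation: by the kernel theorem of Ingham and
Jurkat–Peyerimhoff (`kernelTheorem_jurkatPeyerimhoff`) it suffices to exhibit real `y₊`, `y₋` with
`Re h_K(y₊, T) > 1.6383`, `Re h_K(y₋, T) < -1.6383`, `h_K(y,T) = Σ_{|γ|<T} k(γ/T) e^{iγy}/(ρζ'(ρ))`,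
provided every zero with `|γ| < T` is simple and on the line. Here `T = 5000` and the checker is
TIERED: writing `Re h_K(y) = Σ_{0<γ<T} F_y(γ)`, `F_y(γ) = 2 Re [k(γ/T) e^{iγy} / (ρ ζ'(ρ))]`,

* the HEAVY zeros (a data-chosen subset) are bracketed to `±16/2^CB` (`CB ≈ log₂|y| + 18`) by one
  evaluation of `ζ(½+it₀)` at scale `2^(CB+76)` with the ball certified evaluator `zetaBall`
  (`ZetaCertifiedEvaluationBall.lean`) and the rotated sign test of `HardyZSignCertificate.lean`,
  and their summands `F_{y±}(γ)` are enclosed over the bracket (as in `MertensCertificateBT.lean`);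
* the LIGHT zeros (the rest) are bracketed to `±2^{-150}` by one evaluation at scale `2^200`, and
  their summands are bounded TRIVIALLY: `|F_y(γ)| ≤ 2k(γ/T)/|ρζ'(ρ)|` for every `y` (a certified
  lower bound of `|ρ ζ'(ρ)|` on the bracket by an integer square root);
* the count `N(5000)` comes from a winding certificate for `ζ(x + 5000 i)`, `½ ≤ x ≤ 2`, and
  Backlund's exact formula (`zetaZeroCount_eq_of_hpieces_stirling`) — it needs no zero data;
* the brackets of all zeros, in increasing height, are separated (`checkOrder`), so that with the
  count they exhaust the zeros below `T` (`ZeroBracketing`, `zeros_below_of_count_eq_card`).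

All data — centres, tiers, `y±`, the table parameters, the winding pieces — enter through a
`CertData` record and are verified, never trusted (wrong data only make a check fail). The numbers
`y±` (integers of about `10 000` bits) are found OUTSIDE Lean by lattice reduction on a Hurst-type
lattice (G. Hurst, Math. Comp. 87 (2018), §4); nothing of that search is trusted here.

## Main result

* `numerics_of_checks : checkTop D = true → checkOrder D = true → checkFinal D bH wL = true →
    (∀ k < NHC D, checkHiChunk D (pT k) (bH k) k = true) → (∀ k < NLC D, checkLightChunk D (pL k) (wL k) k = true) →
    ∃ T > 0, (zeros below T simple, on the line) ∧ (∃ y, 1.6383 < Re h_K(y,T)) ∧ (∃ y, Re h_K(y,T) < -1.6383)`.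

The Bool checks are evaluated by `native_decide` in block files; a two-line file then turns the
result into `BestTrudgian2015_thm1_holds` by the kernel theorem.

## References

* [BestTrudgian2015] D. G. Best, T. S. Trudgian, *Linear relations of zeroes of the zeta-function*,
  Math. Comp. 84 (2015), 2047–2058; arXiv:1209.3843 — Theorem 1.
* [OdlyzkoTeRiele1985] A. M. Odlyzko, H. J. J. te Riele, *Disproof of the Mertens conjecture*,
  J. reine angew. Math. 357 (1985), 138–160 — Theorem p. 144, §4.
* G. Hurst, *Computations of the Mertens function and improved bounds on the Mertens conjecture*,
  Math. Comp. 87 (2018), 1013–1028; arXiv:1610.08551 — §4 (the lattice), §6.3.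
* [Titchmarsh1986] E. C. Titchmarsh, *The Theory of the Riemann Zeta-function*, 2nd ed. — Thm. 9.3, §4.17.
-/

open Finset Complex
open Literature.Analysis.ValidatedNumerics.NumericsMP Literature.NumberTheory.LFunctions.ZetaNumerics
  Literature.NumberTheory.LFunctions Literature.NumberTheory.LFunctions.MertensZeroCertificate
open Literature.Analysis.Complex (HPieces qrot piecesLast piecesLastDir piecesTurns)

/-! ## A certified lower bound of `‖z‖` over a box -/

namespace Literature.Analysis.ValidatedNumerics.NumericsMP

/-- A lower bound (scaled) of `|x|` over the interval `I`: `lo` if `lo > 0`, `-hi` if `hi < 0`,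
else `0`. [folklore] -/
def MI.absLo (I : MI) : ℕ := if 0 < I.lo then I.lo.toNat else if I.hi < 0 then (-I.hi).toNat else 0

/-- `absLo I ≤ |x|·S` for `x ∈ I`. [folklore] -/
theorem MI.absLo_le {S : ℕ} {x : ℝ} {I : MI} (hx : MI.mem S x I) : (MI.absLo I : ℝ) ≤ |x| * S := by
  unfold MI.absLo
  obtain ⟨h1, h2⟩ := hx
  split_ifs with hlo hhi
  · have e : ((I.lo.toNat : ℕ) : ℝ) = (I.lo : ℝ) := by
      have := Int.toNat_of_nonneg hlo.le; exact_mod_cast this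
    rw [e]; exact h1.trans (mul_le_mul_of_nonneg_right (le_abs_self x) (Nat.cast_nonneg S))
  · have e : (((-I.hi).toNat : ℕ) : ℝ) = -(I.hi : ℝ) := by
      have h1' : (((-I.hi).toNat : ℕ) : ℤ) = -I.hi := Int.toNat_of_nonneg (by omega)
      have h2' : (((-I.hi).toNat : ℕ) : ℝ) = ((((-I.hi).toNat : ℕ) : ℤ) : ℝ) := by norm_cast
      rw [h2', h1']; push_cast; ring
    rw [e]
    have : -(x * S) ≤ |x| * S := by rw [← neg_mul]; exact mul_le_mul_of_nonneg_right (neg_le_abs x) (Nat.cast_nonneg S)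
    linarith
  · push_cast; positivity

/-- A lower bound (scaled) of `‖z‖` over the box `A`: `⌊√(absLo(re)² + absLo(im)²)⌋`. [folklore] -/
def MC.normLo (A : MC) : ℕ := Nat.sqrt (MI.absLo A.re ^ 2 + MI.absLo A.im ^ 2)

/-- `normLo A ≤ ‖z‖·S` for `z ∈ A`. [folklore] -/
theorem MC.normLo_le {S : ℕ} {z : ℂ} {A : MC} (hz : MC.mem S z A) : (MC.normLo A : ℝ) ≤ ‖z‖ * S := by
  have hre := MI.absLo_le hz.1
  have him := MI.absLo_le hz.2
  have h0 : (0 : ℝ) ≤ MI.absLo A.re := Nat.cast_nonneg _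
  have h0' : (0 : ℝ) ≤ MI.absLo A.im := Nat.cast_nonneg _
  have hsq : ((MI.absLo A.re : ℝ)) ^ 2 + (MI.absLo A.im : ℝ) ^ 2 ≤ (‖z‖ * S) ^ 2 := by
    have e : (‖z‖ * (S : ℝ)) ^ 2 = (|z.re| * S) ^ 2 + (|z.im| * S) ^ 2 := by
      rw [mul_pow, mul_pow, mul_pow, sq_abs, sq_abs, ← add_mul, Complex.sq_norm, Complex.normSq_apply]; ring
    rw [e]
    have h1 := pow_le_pow_left₀ h0 hre 2
    have h2 := pow_le_pow_left₀ h0' him 2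
    linarith
  have hn : (MC.normLo A : ℝ) ^ 2 ≤ (MI.absLo A.re : ℝ) ^ 2 + (MI.absLo A.im : ℝ) ^ 2 := by
    unfold MC.normLo
    have := Nat.sqrt_le' (MI.absLo A.re ^ 2 + MI.absLo A.im ^ 2)
    exact_mod_cast this
  have hpos : 0 ≤ ‖z‖ * S := by positivity
  nlinarith [sq_nonneg ((MC.normLo A : ℝ) - ‖z‖ * S), Nat.cast_nonneg (α := ℝ) (MC.normLo A)]

end Literature.Analysis.ValidatedNumerics.NumericsMP

namespace Literature.NumberTheory.LFunctions.ZetaNumerics.MertensBT2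

/-! ## Parameters and data -/

/-- The height `T₀ = 5000`. [folklore] -/
def T0N : ℕ := 5000

/-- Low scale `SD = 2^200` (light tier, slopes, Stirling main terms). [folklore] -/
def SD : ℕ := 2 ^ 200

/-- Bits of the light centre grid: `t = c / 2^160`. [folklore] -/
def CL : ℕ := 160

/-- Light block length. [folklore] -/
def CHL : ℕ := 800

/-- `expIFast` parameters at the low scale (`2^200`; guard `16`, `12` doublings, `4` blocks of `6`). [folklore] -/
def PL : FastParams := ⟨200, 16, 12, 6, 4⟩

/-- Tables for the low evaluations with Euler–Maclaurin length `N` (`0` = `1700`), `ν = 100`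
(error `< 2^{-210}` for `t ≤ 5001` at `N = 1700`; `N = 900` suffices below `t = 2500`). [folklore] -/
def tabLoN (N : ℕ) : Option Tables := mkTablesFast2 SD (if N = 0 then 1700 else N) 100 30 60 30 8 30 8

/-- Tables for the low evaluations of the heavy tier (`N = 1700`). [folklore] -/
def tabLo : Option Tables := tabLoN 0

/-- Scale of the top-edge evaluations: `2^120`. [folklore] -/
def ST5 : ℕ := 2 ^ 120

/-- `zetaBoxFast` parameters at the top scale. [folklore] -/
def PT : FastParams := ⟨120, 16, 10, 6, 4⟩

/-- Tables for the top edge: `N = 3200`, `ν = 40`. [folklore] -/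
def tabTop : Option Tables := mkTablesFast2 ST5 3200 40 30 45 40 8 30 8

/-- The certificate data. Zeros are indexed `j = 0, …, NZ-1` in increasing height; every zero has a
light centre `loC[j]` (`t = loC[j]/2^160`, bracket half-width `2^{-150}`) and a tier flag; a heavy
zero also has a hi centre `hiC[j]` (`t₀ = hiC[j]/2^CB`, bracket half-width `16/2^CB`). All table
parameters are untrusted inputs (a bad choice only makes a check fail). [folklore] -/
structure CertData where
  /-- bits of the hi centre grid (`CB = max cb 200`) -/
  cb : ℕ
  /-- hi block length (`≥ 1`) -/
  ch : ℕ
  /-- hi tables: Euler–Maclaurin length `N` -/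
  emN : ℕ
  /-- hi tables: number of correction terms `ν` -/
  emNu : ℕ
  /-- hi tables: guard bits -/
  tg : ℕ
  /-- hi tables: series lengths (`π`, `exp`, `expI`) -/
  kpi : ℕ
  /-- hi tables: series lengths -/
  kexp : ℕ
  /-- hi tables: series lengths -/
  kexp2 : ℕ
  /-- hi tables: series lengths -/
  ki : ℕ
  /-- hi tables: series lengths -/
  ki2 : ℕ
  /-- `expIFast` at the hi scale: guard bits -/
  fg : ℕ
  /-- `expIFast` at the hi scale: doublings -/
  fk : ℕ
  /-- `expIFast` at the hi scale: block length -/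
  fm : ℕ
  /-- `expIFast` at the hi scale: blocks -/
  fI : ℕ
  /-- light centres of all zeros, `t = loC[j] / 2^160`, increasing -/
  loC : Array ℕ
  /-- tier flags -/
  isHi : Array Bool
  /-- hi centres, `t₀ = hiC[j] / 2^CB` (meaningful where `isHi[j]`) -/
  hiC : Array ℕ
  /-- `y₊` -/
  yPlus : ℤ
  /-- `y₋` -/
  yMinus : ℤ
  /-- winding certificate for `ζ(x + 5000 i)`, `½ ≤ x ≤ 2` (`(x·2¹², label)`) -/
  pieces : List (ℕ × Fin 4)

variable (D : CertData)

/-- Bits of the hi centre grid, `≥ 200`. [folklore] -/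
def CB : ℕ := max D.cb 200
/-- Bits of the hi scale: `SB = CB + 76`. [folklore] -/
def SB : ℕ := CB D + 76
/-- Hi scale `S = 2^SB`. [folklore] -/
def S : ℕ := 2 ^ SB D
/-- Hi block length (`≥ 1`). [folklore] -/
def CHh : ℕ := max D.ch 1
/-- Number of zeros. [folklore] -/
def NZ : ℕ := D.loC.size
/-- Light centre integer. [folklore] -/
def loCtr (j : ℕ) : ℕ := D.loC.getD j 0
/-- Hi centre integer. [folklore] -/
def hiCtr (j : ℕ) : ℕ := D.hiC.getD j 0
/-- Tier flag. [folklore] -/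
def isHiB (j : ℕ) : Bool := D.isHi.getD j false
/-- The heavy zeros (indices, increasing). [folklore] -/
def hiIdx : List ℕ := (List.range (NZ D)).filter fun j ↦ isHiB D j
/-- The light zeros (indices, increasing). [folklore] -/
def loIdx : List ℕ := (List.range (NZ D)).filter fun j ↦ !isHiB D j
/-- Number of heavy zeros. [folklore] -/
def NH : ℕ := (hiIdx D).length
/-- Number of light zeros. [folklore] -/
def NL : ℕ := (loIdx D).length
/-- Number of hi blocks. [folklore] -/
def NHC : ℕ := NH D / CHh D + 1
/-- Number of light blocks. [folklore] -/
def NLC : ℕ := NL D / CHL + 1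
/-- `expIFast`/`zetaBoxFast` parameters at the hi scale. [folklore] -/
def FP : FastParams := ⟨SB D, D.fg, D.fk, D.fm, D.fI⟩
/-- `zetaBall` parameters at the hi scale with `νT` correction terms (`0` = the record's `emNu`). [folklore] -/
def BP (νT : ℕ) : BallParams := ⟨SB D, D.fg, D.fk, D.fm, D.fI, if νT = 0 then D.emNu else νT⟩
/-- Tables for the hi evaluations with Euler–Maclaurin parameters `(N, ν, νT)` (per block: length,
exact Bernoulli terms, total terms; `0` = the record's defaults). [folklore] -/
def tabHi (pp : ℕ × ℕ × ℕ) : Option Tables :=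
  let N := if pp.1 = 0 then D.emN else pp.1
  let ν := if pp.2.1 = 0 then D.emNu else pp.2.1
  mkTablesFast2 (S D) N ν D.tg D.kpi D.kexp D.kexp2 D.ki D.ki2

/-- Light centre `t = loC[j]/2^160`. [folklore] -/
noncomputable def tL (j : ℕ) : ℝ := (loCtr D j : ℝ) / 2 ^ CL
/-- Light half-width `2^10/2^160 = 2^{-150}`. [folklore] -/
noncomputable def radL : ℝ := 2 ^ 10 / 2 ^ CL
/-- Hi centre `t₀ = hiC[j]/2^CB`. [folklore] -/
noncomputable def tH (j : ℕ) : ℝ := (hiCtr D j : ℝ) / 2 ^ CB D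
/-- Hi half-width `16/2^CB`. [folklore] -/
noncomputable def radH : ℝ := 16 / 2 ^ CB D
/-- Lower end of the bracket of zero `j` (by tier). [folklore] -/
noncomputable def aBr (j : ℕ) : ℝ := if isHiB D j then tH D j - radH D else tL D j - radL
/-- Upper end of the bracket of zero `j` (by tier). [folklore] -/
noncomputable def bBr (j : ℕ) : ℝ := if isHiB D j then tH D j + radH D else tL D j + radL

/-- The kernel transform `k(t) = g(t/T₀)`, `T₀ = 5000`. [cite: OdlyzkoTeRiele1985, §4.1 (4.1) p. 150] -/
noncomputable def kT (t : ℝ) : ℂ := (jurkatPeyerimhoffKernel (t / T0N) : ℂ)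

/-- The summand `F_y(γ) = 2 Re [k(γ) e^{iγy} / (ρ ζ'(ρ))]`. [cite: OdlyzkoTeRiele1985, Theorem p. 144] -/
noncomputable def term (y γ : ℝ) : ℝ := 2 * (inghamTerm kT y γ).re

/-! ## The checkers -/

/-- The exact interval `½` at scale `sc`. [folklore] -/
def halfAt (sc : ℕ) : MI := MI.ofFrac sc 1 2

/-- Enclosure of `g(u)`, `u = γ/T₀`, for `γ` in `G` (`0 ≤ u ≤ 1`), at scale `T.S = 2^P.sb`. [cite: OdlyzkoTeRiele1985, §4.1 (4.1) p. 150] -/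
def kernelBox (P : FastParams) (T : Tables) (G : MI) : Option MI :=
  let U := G.divNat T0N
  match MC.expIFast P.sb P.guard P.k P.m P.I T.piI (MI.mul T.S U T.piI) with
  | none => none
  | some E =>
    match MI.divPos T.S E.im T.piI with
    | none => none
    | some sdiv => some ((MI.mul T.S ((MI.ofInt T.S 1).sub U) E.re).add sdiv)

/-- Enclosure of `2 Re [e^{iγy} g / Den]` for `γ ∈ G`, `y` an integer, at scale `T.S = 2^P.sb`. [folklore] -/
def termBox (P : FastParams) (T : Tables) (G g : MI) (Den : MC) (y : ℤ) : Option MI :=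
  match MC.expIFast P.sb P.guard P.k P.m P.I T.piI (G.mulInt y) with
  | none => none
  | some E2 =>
    match MC.divBox T.S (E2.mulMI T.S g) Den with
    | none => none
    | some F => some (F.re.mulInt 2)

/-- Widening of the slope (scale `SD`): `4 (T₀+5)³ 2^{141} ≥ (t₂-t₁) · 4(t₂+4)³ · SD` for `t₂ ≤ T₀+1`. [folklore] -/
def rSlope : ℤ := 4 * ((T0N : ℤ) + 5) ^ 3 * 2 ^ 141

/-- The rough derivative: a box at scale `SD` containing `ζ'(½ + iγ)` for every `γ` with
`|γ - u 2^{-140}| ≤ 2^{-60}` (slope of `ζ` between `u2^{-140} ∓ 2^{-60}`). [folklore] -/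
def derivBox (Tl : Tables) (u : ℕ) : Option MC :=
  match zetaBoxFast Tl PL ⟨halfAt SD, MI.ofScaled (((u : ℤ) - 2 ^ 80) * 2 ^ 60)⟩,
    zetaBoxFast Tl PL ⟨halfAt SD, MI.ofScaled (((u : ℤ) + 2 ^ 80) * 2 ^ 60)⟩ with
  | some Z1, some Z2 => some ((MC.mulNegI ((Z2.sub Z1).mulInt (2 ^ 59))).widen rSlope)
  | _, _ => none

/-- The Stirling main term `M(t) = (t/2) log(t/2π) - t/2 - π/8` enclosed at scale `SD` over all `t`
with `t · 2^{140} ∈ [u-2, u+2]`, and an upper bound `R` for `2K(¼)/t` there. [cite: Titchmarsh1986, §4.17] -/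
def stirlingBox (Tl : Tables) (u : ℕ) : Option (MI × MI) :=
  let piI := Tl.piI
  match MI.logNat SD 240 (u - 2), MI.logNat SD 240 (u + 2), MI.logTwo SD 240,
    MI.divPos SD (MI.ofInt SD 3) piI with
  | some la, some lb, some l2, some q =>
    match MI.logNat SD 240 3, MI.logOneSub SD 240 ((MI.ofInt SD 1).sub q) with
    | some l3, some lq =>
      let lpi := l3.sub lq
      let lt := (la.span lb).sub (l2.mulInt 140)
      let L := (lt.sub l2).sub lpi
      let tI : MI := ⟨((u : ℤ) - 2) * 2 ^ 60, ((u : ℤ) + 2) * 2 ^ 60⟩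
      let th := tI.divNat 2
      let M := ((MI.mul SD L th).sub th).sub (piI.divNat 8)
      let K := ((MI.ofFrac SD 1 6).add (MI.ofFrac SD 5 32)).add (piI.divNat 12)
      match MI.divPos SD (K.mulInt 2) (MI.lower tI) with
      | none => none
      | some R => some (M, R)
    | _, _ => none
  | _, _, _, _ => none

/-- The Stirling condition `2((M.hi - M.lo) + R.hi) < piI.lo`. [folklore] -/
def stirlingOk (Tl : Tables) (M R : MI) : Bool :=
  decide (2 * ((M.hi - M.lo) + R.hi) < Tl.piI.lo)

/-- The rotated sign conditions at scale `sc`, the derivative box `DB` (scale `SD`) rescaled by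
`2^{-sh}` so that it represents `r · ζ'` at scale `sc`. [folklore] -/
def rotSignOk (sc sh : ℕ) (Eφ W DB : MC) : Bool :=
  let RD : MC := ⟨DB.re.divNat (2 ^ sh), DB.im.divNat (2 ^ sh)⟩
  let P1 := MC.mul sc Eφ (W.sub (MC.mulI RD))
  let P2 := MC.mul sc Eφ (W.add (MC.mulI RD))
  decide ((P1.re.hi < -1 ∧ 1 < P2.re.lo) ∨ (1 < P1.re.lo ∧ P2.re.hi < -1))

/-- Bounds `(lo, hi)` (scale `S`) of the summands at `y₊`, `y₋` over the hi bracket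
`G = [c-16, c+16] / 2^CB`, the derivative ranging over `DB` (low scale, rescaled). [folklore] -/
def termsOfHi (Th : Tables) (c : ℕ) (DB : MC) : Option (ℤ × ℤ) :=
  let G : MI := ⟨((c : ℤ) - 16) * 2 ^ 76, ((c : ℤ) + 16) * 2 ^ 76⟩
  let DBS : MC := ⟨MI.rescale SD Th.S DB.re, MI.rescale SD Th.S DB.im⟩
  let Den := MC.mul Th.S ⟨halfAt Th.S, G⟩ DBS
  match kernelBox (FP D) Th G with
  | none => none
  | some g =>
    match termBox (FP D) Th G g Den D.yPlus, termBox (FP D) Th G g Den D.yMinus with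
    | some FP', some FM => some (FP'.lo, FM.hi)
    | _, _ => none

/-- The hi centre on the `2^{-140}` grid. [folklore] -/
def uOfHi (c : ℕ) : ℕ := c / 2 ^ (CB D - 140)

/-- **The heavy-zero computation** from the centre integer `c`: `W ∋ ζ(½+it₀)` (hi scale), the
derivative box, the Stirling angle and rotation, the sign conditions (`r = 16/2^CB`), and the bounds
of the summands at `y₊`, `y₋` over the bracket. [folklore] -/
def hiCheck (Th Tl : Tables) (νT : ℕ) (c : ℕ) : Option (ℤ × ℤ) :=
  match zetaBall Th (BP D νT) ⟨halfAt Th.S, MI.ofScaled ((c : ℤ) * 2 ^ 76)⟩, derivBox Tl (uOfHi D c),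
    stirlingBox Tl (uOfHi D c) with
  | some W, some DB, some (M, R) =>
    match MC.expIFast (SB D) D.fg D.fk D.fm D.fI Th.piI (MI.ofScaled (M.lo * 2 ^ (SB D - 200))) with
    | some Eφ =>
      if stirlingOk Tl M R ∧ rotSignOk Th.S 120 Eφ W DB then termsOfHi D Th c DB else none
    | none => none
  | _, _, _ => none

/-- The weight bound `⌈2 · max(|g|) · 2^60 / normLo(Den)⌉` (an integer at scale `2^60`). [folklore] -/
def weightBound (g : MI) (Den : MC) : Option ℕ :=
  let q := MC.normLo Den
  if q = 0 then none else some ((2 * (MI.absHi g).toNat * 2 ^ 60) / q + 1)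

/-- The light centre on the `2^{-140}` grid. [folklore] -/
def uOfLo (cl : ℕ) : ℕ := cl / 2 ^ 20

/-- **The light-zero computation** from the centre integer `cl` (`t = cl/2^160`): the sign
conditions with `r = 2^{-150}` at scale `2^200`, and the weight bound over the bracket. [folklore] -/
def lightCheck (Tl : Tables) (cl : ℕ) : Option ℕ :=
  match zetaBoxFast Tl PL ⟨halfAt SD, MI.ofScaled ((cl : ℤ) * 2 ^ 40)⟩, derivBox Tl (uOfLo cl),
    stirlingBox Tl (uOfLo cl) with
  | some W, some DB, some (M, R) =>
    match MC.expIFast 200 16 12 6 4 Tl.piI (MI.ofScaled M.lo) with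
    | some Eφ =>
      if stirlingOk Tl M R ∧ rotSignOk SD 150 Eφ W DB then
        let G : MI := ⟨((cl : ℤ) - 2 ^ 10) * 2 ^ 40, ((cl : ℤ) + 2 ^ 10) * 2 ^ 40⟩
        let Den := MC.mul SD ⟨halfAt SD, G⟩ DB
        match kernelBox PL Tl G with
        | none => none
        | some g => weightBound g Den
      else none
    | none => none
  | _, _, _ => none

/-- Ordering of the light brackets: `8 ≤ t - r`, `t + r < T₀`, `t_j + r < t_{j+1} - r`. [folklore] -/
def orderOk (j : ℕ) : Bool :=
  decide (8 * 2 ^ CL + 2 ^ 10 ≤ loCtr D j ∧ loCtr D j + 2 ^ 10 < T0N * 2 ^ CL ∧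
    (j + 1 < NZ D → loCtr D j + 2 ^ 11 < loCtr D (j + 1)))

/-- Nesting: the hi bracket of a heavy zero lies inside its light bracket. [folklore] -/
def nestOk (j : ℕ) : Bool :=
  !(isHiB D j) || decide (((loCtr D j : ℤ) - 2 ^ 10) * 2 ^ (CB D - CL) ≤ (hiCtr D j : ℤ) - 16 ∧
    (hiCtr D j : ℤ) + 16 ≤ ((loCtr D j : ℤ) + 2 ^ 10) * 2 ^ (CB D - CL))

/-- **Order check** over all zeros. [folklore] -/
def checkOrder : Bool := (List.range (NZ D)).all fun j ↦ orderOk D j && nestOk D j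

/-- Accumulated `(Σ lo, Σ hi)` over the first `i` heavy zeros of block `k` (ranks `k·CH + i'`),
ranks beyond `NH` contributing nothing; `none` on any failure. [folklore] -/
def hiSums (Th Tl : Tables) (νT : ℕ) (k : ℕ) : ℕ → Option (ℤ × ℤ)
  | 0 => some (0, 0)
  | i + 1 =>
    match hiSums Th Tl νT k i with
    | none => none
    | some (sl, sh) =>
      if k * CHh D + i < NH D then
        match hiCheck D Th Tl νT (hiCtr D ((hiIdx D).getD (k * CHh D + i) 0)) with
        | some (vlo, vhi) => some (sl + vlo, sh + vhi)
        | none => none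
      else some (sl, sh)

/-- Comparison with the claimed block bounds `b = (L, U)` (scaled from `2^60` to `S`). [folklore] -/
def boundsOk (b : ℤ × ℤ) : Option (ℤ × ℤ) → Bool
  | none => false
  | some (sl, sh) => decide (b.1 * 2 ^ (SB D - 60) ≤ sl ∧ sh ≤ b.2 * 2 ^ (SB D - 60))

/-- Hi block check with given tables. [folklore] -/
def checkHiChunkWith (Th Tl : Tables) (νT : ℕ) (b : ℤ × ℤ) (k : ℕ) : Bool :=
  boundsOk D b (hiSums D Th Tl νT k (CHh D))

/-- **Hi block check `k`** with evaluation parameters `pp = (N, ν, νT)` against the claimed bounds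
`b` (evaluated only by `native_decide`). [folklore] -/
def checkHiChunk (pp : ℕ × ℕ × ℕ) (b : ℤ × ℤ) (k : ℕ) : Bool :=
  ((tabHi D pp).bind fun Th ↦ tabLo.map fun Tl ↦ checkHiChunkWith D Th Tl pp.2.2 b k).getD false

/-- Accumulated weight bounds over the first `i` light zeros of block `k`. [folklore] -/
def loSums (Tl : Tables) (k : ℕ) : ℕ → Option ℕ
  | 0 => some 0
  | i + 1 =>
    match loSums Tl k i with
    | none => none
    | some w =>
      if k * CHL + i < NL D then
        match lightCheck Tl (loCtr D ((loIdx D).getD (k * CHL + i) 0)) with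
        | some wB => some (w + wB)
        | none => none
      else some w

/-- Light block check with given tables: the accumulated weight bound is at most `w`. [folklore] -/
def checkLightChunkWith (Tl : Tables) (w : ℕ) (k : ℕ) : Bool :=
  match loSums D Tl k CHL with
  | none => false
  | some s => decide (s ≤ w)

/-- **Light block check `k`** with low Euler–Maclaurin length `N` against the claimed weight `w`
(evaluated only by `native_decide`). [folklore] -/
def checkLightChunk (N : ℕ) (w : ℕ) (k : ℕ) : Bool := ((tabLoN N).map fun Tl ↦ checkLightChunkWith D Tl w k).getD false

/-! ### The top edge -/

/-- The box `[x₀, x₁]/2¹² × {T₀}` at scale `ST5`. [folklore] -/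
def topBox (x0 x1 : ℕ) : MC :=
  ⟨⟨(x0 : ℤ) * (ST5 / 4096 : ℕ), (x1 : ℤ) * (ST5 / 4096 : ℕ)⟩, MI.ofInt ST5 T0N⟩

/-- Check of a piece list along the top edge from `x₀/2¹²`. [folklore] -/
def checkPieces (T : Tables) : ℕ → List (ℕ × Fin 4) → Bool
  | _, [] => true
  | x0, (x1, d) :: ps =>
    decide (x0 ≤ x1) &&
    (match zetaBoxFast T PT (topBox x0 x1) with
      | none => false
      | some Z => Mertens.labelOk d Z) &&
    checkPieces T x1 ps

/-- Enclosure check of the Stirling inequality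
`|M(T₀)/π + 1 − turns/2 − n| + 2K(¼)/(πT₀) ≤ ½` at scale `ST5`. [cite: Titchmarsh1986, Thm. 9.3 and §4.17] -/
def checkStirling (T : Tables) (n : ℕ) (turns : ℤ) : Bool :=
  let S := ST5
  let piI := T.piI
  match MI.logNat S 160 T0N, MI.logTwo S 160, MI.divPos S (MI.ofInt S 3) piI with
  | some lT, some l2, some q =>
    match MI.logNat S 160 3, MI.logOneSub S 160 ((MI.ofInt S 1).sub q) with
    | some l3, some lq =>
      let lpi := l3.sub lq
      let L := (lT.sub l2).sub lpi
      let M := ((MI.mul S L (MI.ofFrac S T0N 2)).sub (MI.ofFrac S T0N 2)).sub (piI.divNat 8)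
      match MI.divPos S M piI with
      | none => false
      | some Mpi =>
        let W := ((Mpi.add (MI.ofInt S 1)).sub (MI.ofFrac S turns 2)).sub (MI.ofInt S n)
        let K := ((MI.ofFrac S 1 6).add (MI.ofFrac S 5 32)).add (piI.divNat 12)
        match MI.divPos S (K.mulInt 2) (MI.mul S piI (MI.ofInt S T0N)) with
        | none => false
        | some R => decide (2 * (W.absHi + R.hi) ≤ (S : ℤ))
    | _, _ => false
  | _, _, _ => false

/-- Top-edge check with given tables, piece list and claimed count `n`. [folklore] -/
def checkTopWith (T : Tables) (n : ℕ) : List (ℕ × Fin 4) → Bool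
  | [] => false
  | (x1, d1) :: ps =>
    checkPieces T 2048 ((x1, d1) :: ps) && decide (Mertens.lastX x1 ps = 8192) &&
      decide (Mertens.lastDirN d1 ps = 0) && checkStirling T n (Mertens.turnsN d1 ps)

/-- **Top-edge check**: `N(5000) = NZ`. [folklore] -/
def checkTop : Bool := (tabTop.map fun T ↦ checkTopWith T (NZ D) D.pieces).getD false

/-! ### The final comparison -/

/-- Sum of the claimed hi lower bounds. [folklore] -/
def sumL (bH : ℕ → ℤ × ℤ) : ℤ := ∑ k ∈ Finset.range (NHC D), (bH k).1
/-- Sum of the claimed hi upper bounds. [folklore] -/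
def sumU (bH : ℕ → ℤ × ℤ) : ℤ := ∑ k ∈ Finset.range (NHC D), (bH k).2
/-- Sum of the claimed light weights. [folklore] -/
def sumW (wL : ℕ → ℕ) : ℤ := ∑ k ∈ Finset.range (NLC D), (wL k : ℤ)

/-- **Final check**: `Σ L_k − Σ w_k > 1.6383 · 2^60` and `Σ U_k + Σ w_k < -1.6383 · 2^60`. [folklore] -/
def checkFinal (bH : ℕ → ℤ × ℤ) (wL : ℕ → ℕ) : Bool :=
  decide (16383 * 2 ^ 60 < 10000 * (sumL D bH - sumW D wL) ∧
    10000 * (sumU D bH + sumW D wL) < -16383 * 2 ^ 60)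

/-! ## Soundness -/

section Soundness

variable {D}

/-- [folklore] -/
lemma le_CB : 200 ≤ CB D := le_max_right _ _
/-- [folklore] -/
lemma SB_eq : SB D = CB D + 76 := rfl
/-- [folklore] -/
lemma S_eq : S D = 2 ^ SB D := rfl
/-- [folklore] -/
lemma S_pos : 0 < S D := by rw [S_eq]; positivity
/-- [folklore] -/
lemma SD_pos : 0 < SD := by unfold SD; positivity
/-- `S = 2^CB · 2^76`. [folklore] -/
lemma S_real : (S D : ℝ) = 2 ^ CB D * 2 ^ 76 := by
  rw [S_eq, SB_eq]; push_cast; ring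
/-- `S = 2^200 · 2^(SB-200)`. [folklore] -/
lemma S_real' : (S D : ℝ) = 2 ^ 200 * 2 ^ (SB D - 200) := by
  have h := le_CB (D := D)
  set k : ℕ := SB D - 200 with hk
  have e : SB D = 200 + k := by rw [hk, SB_eq]; omega
  rw [S_eq, e]; push_cast; ring
/-- `S = 2^60 · 2^(SB-60)`. [folklore] -/
lemma S_real'' : (S D : ℝ) = 2 ^ 60 * 2 ^ (SB D - 60) := by
  have h := le_CB (D := D)
  set k : ℕ := SB D - 60 with hk
  have e : SB D = 60 + k := by rw [hk, SB_eq]; omega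
  rw [S_eq, e]; push_cast; ring
/-- `SD = 2^140 · 2^60`. [folklore] -/
lemma SD_real : (SD : ℝ) = 2 ^ 140 * 2 ^ 60 := by
  unfold SD; push_cast; ring
/-- `SD = 2^200`. [folklore] -/
lemma SD_real' : (SD : ℝ) = 2 ^ 200 := by unfold SD; push_cast; ring
/-- `SD = 2^PL.sb`. [folklore] -/
lemma SD_eq_PL : SD = 2 ^ PL.sb := rfl
/-- `2^CB = 2^140 · 2^(CB - 140)`. [folklore] -/
lemma twoCB_real : (2 : ℝ) ^ CB D = 2 ^ 140 * 2 ^ (CB D - 140) := by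
  have h := le_CB (D := D)
  set k : ℕ := CB D - 140 with hk
  have e : CB D = 140 + k := by omega
  rw [e]; ring
/-- `2^140 · 2^(CB-140) = 2^CB` in `ℕ`. [folklore] -/
lemma CB_split : 2 ^ 140 * 2 ^ (CB D - 140) = 2 ^ CB D := by
  have h := le_CB (D := D)
  set k : ℕ := CB D - 140 with hk
  have e : CB D = 140 + k := by omega
  rw [e, pow_add]
/-- `CL = 160`. [folklore] -/
lemma CL_eq : CL = 160 := rfl
/-- `2^CB = 2^CL · 2^(CB-CL)` in `ℤ`. [folklore] -/
lemma twoCB_CL : (2 : ℤ) ^ CB D = 2 ^ CL * 2 ^ (CB D - CL) := by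
  have h := le_CB (D := D)
  set k : ℕ := CB D - CL with hk
  have e : CB D = CL + k := by rw [hk, CL_eq]; omega
  rw [e, pow_add]
/-- [folklore] -/
lemma T0N_real : (T0N : ℝ) = 5000 := by unfold T0N; norm_num
/-- [folklore] -/
lemma T0N_pos : 0 < T0N := by unfold T0N; norm_num
/-- [folklore] -/
lemma radH_pos : 0 < radH D := by unfold radH; positivity
/-- [folklore] -/
lemma radL_pos : 0 < radL := by unfold radL; positivity
/-- `rH ≤ 2^{-64}`. [folklore] -/
lemma radH_le : radH D ≤ 1 / 2 ^ 64 := by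
  unfold radH
  rw [div_le_div_iff₀ (by positivity) (by positivity), one_mul]
  calc (16 : ℝ) * 2 ^ 64 = 2 ^ 68 := by norm_num
    _ ≤ 2 ^ CB D := pow_le_pow_right₀ (by norm_num) (le_trans (by norm_num) le_CB)
/-- `rL = 2^{-150}`. [folklore] -/
lemma radL_eq : radL = 1 / 2 ^ 150 := by unfold radL CL; norm_num
/-- [folklore] -/
lemma CHh_pos : 0 < CHh D := lt_of_lt_of_le Nat.one_pos (le_max_right _ _)
/-- [folklore] -/
lemma CHL_pos : 0 < CHL := by unfold CHL; norm_num

/-! The scales are huge powers of two: no tactic may ever evaluate them. -/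
attribute [irreducible] SD CL

/-- Transport of interval membership between scales along an exact identity `x · S₁ = x' · S₂`. [folklore] -/
lemma MI.mem_of_mul_eq {S₁ S₂ : ℕ} {x x' : ℝ} {I : MI} (h : MI.mem S₁ x I) (e : x * S₁ = x' * S₂) :
    MI.mem S₂ x' I := by
  rw [MI.mem_def] at h ⊢; rw [← e]; exact h

/-- [folklore] -/
lemma tabHi_valid {pp : ℕ × ℕ × ℕ} {T : Tables} (h : tabHi D pp = some T) : T.Valid := by
  unfold tabHi at h; exact mkTablesFast2_valid h
/-- [folklore] -/
lemma tabHi_S {pp : ℕ × ℕ × ℕ} {T : Tables} (h : tabHi D pp = some T) : T.S = S D := by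
  unfold tabHi at h; exact mkTablesFast2_S h
/-- [folklore] -/
lemma tabLoN_valid {N : ℕ} {T : Tables} (h : tabLoN N = some T) : T.Valid := by
  unfold tabLoN at h; exact mkTablesFast2_valid h
/-- [folklore] -/
lemma tabLoN_S {N : ℕ} {T : Tables} (h : tabLoN N = some T) : T.S = SD := by
  unfold tabLoN at h; exact mkTablesFast2_S h
/-- [folklore] -/
lemma tabLo_valid {T : Tables} (h : tabLo = some T) : T.Valid := tabLoN_valid h
/-- [folklore] -/
lemma tabLo_S {T : Tables} (h : tabLo = some T) : T.S = SD := tabLoN_S h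
/-- [folklore] -/
lemma tabTop_valid {T : Tables} (h : tabTop = some T) : T.Valid := mkTablesFast2_valid h
/-- [folklore] -/
lemma tabTop_S {T : Tables} (h : tabTop = some T) : T.S = ST5 := mkTablesFast2_S h

attribute [irreducible] tabHi tabLoN tabLo tabTop

/-! ### The kernel and the summands -/

/-- Soundness of `kernelBox`. [cite: OdlyzkoTeRiele1985, §4.1 (4.1) p. 150] -/
theorem mem_kernelBox {P : FastParams} {T : Tables} (hT : T.Valid) (hTS : T.S = 2 ^ P.sb) {G g : MI}
    (h : kernelBox P T G = some g) {γ : ℝ} (hγ : MI.mem T.S γ G) (h0 : 0 ≤ γ)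
    (h1 : γ ≤ T0N) : MI.mem T.S (jurkatPeyerimhoffKernel (γ / T0N)) g := by
  have hpi : MI.mem T.S Real.pi T.piI := hT.mem_pi
  have hS : 0 < T.S := hT.S_pos
  unfold kernelBox at h
  simp only at h
  split at h
  · simp at h
  · rename_i E hE
    split at h
    · simp at h
    · rename_i sdiv hsdiv
      simp only [Option.some.injEq] at h
      subst h
      set u : ℝ := γ / T0N with hu
      have hU : MI.mem T.S u (G.divNat T0N) := MI.mem_divNat hγ T0N_pos
      have hΦ : MI.mem T.S (u * Real.pi) (MI.mul T.S (G.divNat T0N) T.piI) := MI.mem_mul hS hU hpi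
      have hpi' : MI.mem (2 ^ P.sb) Real.pi T.piI := by rw [← hTS]; exact hpi
      have hΦ' : MI.mem (2 ^ P.sb) (u * Real.pi) (MI.mul T.S (G.divNat T0N) T.piI) := by rw [← hTS]; exact hΦ
      have hEm : MC.mem T.S (Complex.exp ((u * Real.pi : ℝ) * I)) E := by
        have := MC.mem_expIFast hpi' hE hΦ'
        rw [← hTS] at this; exact this
      have hcos : MI.mem T.S (Real.cos (u * Real.pi)) E.re := by
        have := hEm.1; rwa [Complex.exp_ofReal_mul_I_re] at this
      have hsin : MI.mem T.S (Real.sin (u * Real.pi)) E.im := by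
        have := hEm.2; rwa [Complex.exp_ofReal_mul_I_im] at this
      have hdiv := MI.mem_divPos hS hsdiv hsin hpi
      have hone : MI.mem T.S (((1 : ℤ) : ℝ) - u) ((MI.ofInt T.S 1).sub (G.divNat T0N)) :=
        MI.mem_sub (MI.mem_ofInt T.S 1) hU
      have hres := MI.mem_add (MI.mem_mul hS hone hcos) hdiv
      have hT0 : (0 : ℝ) < T0N := by rw [T0N_real]; norm_num
      have hu0 : 0 ≤ u := div_nonneg h0 hT0.le
      have hu1 : u ≤ 1 := by rw [hu, div_le_one hT0]; exact h1
      have hval : jurkatPeyerimhoffKernel u =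
          (((1 : ℤ) : ℝ) - u) * Real.cos (u * Real.pi) + Real.sin (u * Real.pi) / Real.pi := by
        unfold jurkatPeyerimhoffKernel
        rw [abs_of_nonneg hu0, if_pos hu1, mul_comm Real.pi u, Int.cast_one]
        ring
      rw [hval]
      exact hres

/-- Soundness of `termBox`: for `γ ∈ G`, `gv ∈ g`, `w ∈ Den`, `2 Re [e^{iγy} gv / w] ∈ termBox`. [folklore] -/
theorem mem_termBox {P : FastParams} {T : Tables} (hT : T.Valid) (hTS : T.S = 2 ^ P.sb) {G g : MI}
    {Den : MC} {y : ℤ} {F : MI} (h : termBox P T G g Den y = some F) {γ : ℝ} (hγ : MI.mem T.S γ G) {gv : ℝ}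
    (hg : MI.mem T.S gv g) {w : ℂ} (hw : MC.mem T.S w Den) :
    MI.mem T.S ((cexp (((γ * (y : ℝ) : ℝ) : ℂ) * I) * (gv : ℂ) / w).re * 2) F := by
  have hpi : MI.mem T.S Real.pi T.piI := hT.mem_pi
  have hS : 0 < T.S := hT.S_pos
  unfold termBox at h
  split at h
  · simp at h
  · rename_i E2 hE2
    split at h
    · simp at h
    · rename_i F' hF'
      simp only [Option.some.injEq] at h
      subst h
      have hΘ : MI.mem T.S (γ * (y : ℝ)) (G.mulInt y) := MI.mem_mulInt hγ y
      have hpi' : MI.mem (2 ^ P.sb) Real.pi T.piI := by rw [← hTS]; exact hpi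
      have hΘ' : MI.mem (2 ^ P.sb) (γ * (y : ℝ)) (G.mulInt y) := by rw [← hTS]; exact hΘ
      have hE : MC.mem T.S (cexp (((γ * (y : ℝ) : ℝ) : ℂ) * I)) E2 := by
        have := MC.mem_expIFast hpi' hE2 hΘ'
        rw [← hTS] at this; exact this
      have hP := MC.mem_mulMI hS hE hg
      have hF := MC.mem_divBox hS hF' hP hw
      exact MI.mem_mulInt hF.1 2

/-- The summand in the form produced by the checker. [folklore] -/
lemma term_eq (y : ℤ) (γ : ℝ) :
    term y γ = (cexp (((γ * (y : ℝ) : ℝ) : ℂ) * I) * (jurkatPeyerimhoffKernel (γ / T0N) : ℂ) /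
      ((1 / 2 + γ * I) * deriv riemannZeta (1 / 2 + γ * I))).re * 2 := by
  unfold term inghamTerm kT
  rw [mul_comm (2 : ℝ)]
  congr 3
  rw [mul_comm]
  congr 2
  push_cast; ring

/-- The modulus bound `|F_y(γ)| ≤ 2 |k(γ/T₀)| / |ρ ζ'(ρ)|`. [folklore] -/
lemma abs_term_le (y γ : ℝ) (_hw : (1 / 2 + γ * I) * deriv riemannZeta (1 / 2 + γ * I) ≠ 0) :
    |term y γ| ≤ 2 * |jurkatPeyerimhoffKernel (γ / T0N)| /
      ‖(1 / 2 + γ * I) * deriv riemannZeta (1 / 2 + γ * I)‖ := by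
  have key : ∀ (z e w : ℂ), ‖e‖ = 1 → |2 * (z * e / w).re| ≤ 2 * ‖z‖ / ‖w‖ := by
    intro z e w he
    have h1 : |(z * e / w).re| ≤ ‖z * e / w‖ := Complex.abs_re_le_norm _
    have h2 : ‖z * e / w‖ = ‖z‖ / ‖w‖ := by rw [norm_div, norm_mul, he, mul_one]
    have h3 : (2 : ℝ) * ‖z‖ / ‖w‖ = 2 * (‖z‖ / ‖w‖) := mul_div_assoc _ _ _
    rw [abs_mul, abs_of_pos (show (0 : ℝ) < 2 by norm_num), h3]
    linarith
  have he : ‖cexp (I * (γ * y))‖ = 1 := by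
    rw [show I * (γ * y) = ((γ * y : ℝ) : ℂ) * I by push_cast; ring, Complex.norm_exp_ofReal_mul_I]
  have := key (jurkatPeyerimhoffKernel (γ / T0N) : ℂ) (cexp (I * (γ * y)))
    ((1 / 2 + γ * I) * deriv riemannZeta (1 / 2 + γ * I)) he
  rw [Complex.norm_real, Real.norm_eq_abs] at this
  unfold term inghamTerm kT
  simpa only [Complex.re_ofReal_mul, mul_div_assoc] using this

/-! ### Inputs -/

/-- Membership of `½ + it` in the low-scale input boxes, `t = k / SD`. [folklore] -/
lemma mem_inputLo {k : ℤ} {t : ℝ} (ht : t = (k : ℝ) / SD) :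
    MC.mem SD (1 / 2 + t * I) ⟨halfAt SD, MI.ofScaled k⟩ := by
  have hre : ((1 : ℂ) / 2 + t * I).re = (1 : ℤ) / (2 : ℕ) := by simp
  have him : ((1 : ℂ) / 2 + t * I).im = t := by simp
  constructor
  · rw [hre]; exact MI.mem_ofFrac SD 1 (q := 2) (by norm_num)
  · rw [him, ht]; exact MI.mem_ofScaled SD_pos k

/-- Membership of `½ + it` in an input box at scale `sc`, `t = k / sc`. [folklore] -/
lemma mem_input {sc : ℕ} (hsc : 0 < sc) {k : ℤ} {t : ℝ} (ht : t = (k : ℝ) / sc) :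
    MC.mem sc (1 / 2 + t * I) ⟨halfAt sc, MI.ofScaled k⟩ := by
  have hre : ((1 : ℂ) / 2 + t * I).re = (1 : ℤ) / (2 : ℕ) := by simp
  have him : ((1 : ℂ) / 2 + t * I).im = t := by simp
  constructor
  · rw [hre]; exact MI.mem_ofFrac sc 1 (q := 2) (by norm_num)
  · rw [him, ht]; exact MI.mem_ofScaled hsc k

/-! ### The rough derivative -/

/-- **Soundness of `derivBox`**: for `8·2^{140} ≤ u < T₀·2^{140}` and every `γ` with
`|γ - u 2^{-140}| ≤ 2^{-60}`, `ζ'(½ + iγ) ∈ derivBox`. [folklore] -/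
theorem mem_derivBox {Tl : Tables} (hT : Tl.Valid) (hTS : Tl.S = SD) {u : ℕ}
    (hu8 : 8 * 2 ^ 140 ≤ u) (huT : u < T0N * 2 ^ 140) {DB : MC}
    (h : derivBox Tl u = some DB) {γ : ℝ} (hγ : |γ - (u : ℝ) / 2 ^ 140| ≤ 1 / 2 ^ 60) :
    MC.mem SD (deriv riemannZeta (1 / 2 + γ * I)) DB := by
  set t₁ : ℝ := (u : ℝ) / 2 ^ 140 - 1 / 2 ^ 60 with ht₁
  set t₂ : ℝ := (u : ℝ) / 2 ^ 140 + 1 / 2 ^ 60 with ht₂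
  have h2p : (0 : ℝ) < 2 ^ 140 := pow_pos (by norm_num) _
  have hu8r : (8 : ℝ) * 2 ^ 140 ≤ u := by exact_mod_cast hu8
  have huTr : (u : ℝ) < T0N * 2 ^ 140 := by exact_mod_cast huT
  have hu8' : 8 ≤ (u : ℝ) / 2 ^ 140 := by rw [le_div_iff₀ h2p]; exact hu8r
  have huT' : (u : ℝ) / 2 ^ 140 < T0N := by rw [div_lt_iff₀ h2p]; exact huTr
  have h60 : (0 : ℝ) < 1 / 2 ^ 60 := by positivity
  have ht1 : 2 ≤ t₁ := by
    rw [ht₁]; have : (1 : ℝ) / 2 ^ 60 ≤ 1 := by norm_num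
    linarith
  have ht12 : t₁ < t₂ := by rw [ht₁, ht₂]; linarith
  have hgap : t₂ - t₁ = 1 / 2 ^ 59 := by
    rw [ht₁, ht₂, show (2 : ℝ) ^ 60 = 2 ^ 59 * 2 by norm_num]; field_simp; ring
  have ht2T : t₂ < T0N + 1 := by
    rw [ht₂]; have : (1 : ℝ) / 2 ^ 60 ≤ 1 := by norm_num
    linarith
  have hγI : γ ∈ Set.Icc t₁ t₂ := by
    rw [ht₁, ht₂]; constructor <;> linarith [(abs_le.1 hγ).1, (abs_le.1 hγ).2]
  have hs1 : (1 / 2 : ℂ) + t₁ * I ≠ 1 := fun h ↦ by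
    have := congrArg Complex.im h; simp at this; linarith
  have hs2 : (1 / 2 : ℂ) + t₂ * I ≠ 1 := fun h ↦ by
    have := congrArg Complex.im h; simp at this; linarith
  have e2 : (2 : ℝ) ^ 200 = 2 ^ 140 * 2 ^ 60 := by norm_num
  have e3 : (2 : ℝ) ^ 140 = 2 ^ 80 * 2 ^ 60 := by norm_num
  have hin1 : MC.mem Tl.S (1 / 2 + t₁ * I) ⟨halfAt SD, MI.ofScaled (((u : ℤ) - 2 ^ 80) * 2 ^ 60)⟩ := by
    rw [hTS]; apply mem_inputLo
    rw [ht₁, SD_real', e2, e3]; push_cast; field_simp; ring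
  have hin2 : MC.mem Tl.S (1 / 2 + t₂ * I) ⟨halfAt SD, MI.ofScaled (((u : ℤ) + 2 ^ 80) * 2 ^ 60)⟩ := by
    rw [hTS]; apply mem_inputLo
    rw [ht₂, SD_real', e2, e3]; push_cast; field_simp; ring
  unfold derivBox at h
  split at h
  · rename_i Z1 Z2 hZ1 hZ2
    simp only [Option.some.injEq] at h
    subst h
    have hm1 := mem_zetaBoxFast hT hin1 hs1 hZ1
    have hm2 := mem_zetaBoxFast hT hin2 hs2 hZ2
    rw [hTS] at hm1 hm2
    have hslope := norm_deriv_riemannZeta_sub_slope_le ht1 ht12 hγI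
    have hD0 : MC.mem SD ((riemannZeta (1 / 2 + t₂ * I) - riemannZeta (1 / 2 + t₁ * I)) /
        ((t₂ - t₁ : ℝ) * I)) (MC.mulNegI ((Z2.sub Z1).mulInt (2 ^ 59))) := by
      have := MC.mem_mulNegI (MC.mem_mulInt (MC.mem_sub hm2 hm1) (2 ^ 59))
      convert this using 1
      rw [hgap, div_eq_mul_inv, mul_inv, Complex.inv_I]
      push_cast
      ring
    apply MC.mem_widen hD0
    refine (mul_le_mul_of_nonneg_right hslope (by positivity)).trans ?_
    rw [hgap, SD_real']
    unfold rSlope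
    push_cast
    have h4 : 0 ≤ t₂ + 4 := by linarith
    have hc : (t₂ + 4) ^ 3 ≤ ((T0N : ℝ) + 5) ^ 3 := pow_le_pow_left₀ h4 (by linarith) 3
    have : (1 : ℝ) / 2 ^ 59 * (4 * (t₂ + 4) ^ 3) * 2 ^ 200 = 4 * (t₂ + 4) ^ 3 * 2 ^ 141 := by
      rw [show (2 : ℝ) ^ 200 = 2 ^ 59 * 2 ^ 141 by norm_num]; field_simp
    rw [this]
    have h141 : (0 : ℝ) ≤ 2 ^ 141 := by positivity
    nlinarith [hc]
  · simp at h

/-! ### The Stirling angle -/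

/-- **Soundness of `stirlingBox` / `stirlingOk`**: for `u ≥ 8 · 2^{140}`, if the check passes then
for every `t` with `t · 2^{140} ∈ [u - 2, u + 2]`, with `φ = M.lo / SD`,
`|φ - ((t/2) log(t/2π) - t/2 - π/8)| + 2K(¼)/t < π/2`. [cite: Titchmarsh1986, §4.17] -/
theorem stirling_sound {Tl : Tables} (hT : Tl.Valid) (hTS : Tl.S = SD) {u : ℕ}
    (hu8 : 8 * 2 ^ 140 ≤ u) {M R : MI} (h : stirlingBox Tl u = some (M, R))
    (hok : stirlingOk Tl M R = true) {t : ℝ}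
    (ht : (u : ℝ) - 2 ≤ t * 2 ^ 140 ∧ t * 2 ^ 140 ≤ (u : ℝ) + 2) :
    |(M.lo : ℝ) / SD - (t / 2 * Real.log (t / (2 * Real.pi)) - t / 2 - Real.pi / 8)| +
      2 * stirlingVertRate (1 / 4) / t < Real.pi / 2 := by
  have hpi : MI.mem SD Real.pi Tl.piI := hTS ▸ hT.mem_pi
  have hSr : (0 : ℝ) < SD := by exact_mod_cast SD_pos
  have h2p : (0 : ℝ) < 2 ^ 140 := pow_pos (by norm_num) _
  have hu8r : (8 : ℝ) * 2 ^ 140 ≤ u := by exact_mod_cast hu8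
  have hu2 : 2 ≤ u := le_trans (by norm_num) (le_trans (Nat.le_mul_of_pos_right 8 (pow_pos (by norm_num) 140)) hu8)
  set v : ℝ := t * 2 ^ 140 with hv
  have hv0 : 0 < v := by rw [hv]; linarith
  have ht0 : 0 < t := by
    by_contra h0; push Not at h0
    have : v ≤ 0 := by rw [hv]; exact mul_nonpos_of_nonpos_of_nonneg h0 h2p.le
    linarith
  have htv : t = v / 2 ^ 140 := by rw [hv]; field_simp
  unfold stirlingBox at h
  simp only at h
  split at h
  · rename_i la lb l2 q hla hlb hl2 hq
    split at h
    · rename_i l3 lq hl3 hlq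
      split at h
      · simp at h
      · rename_i R' hR'
        simp only [Option.some.injEq, Prod.mk.injEq] at h
        obtain ⟨hM, hR⟩ := h
        have hla' := MI.mem_logNat SD_pos hla
        have hlb' := MI.mem_logNat SD_pos hlb
        have hl2' := MI.mem_logTwo SD_pos hl2
        have hl3' := MI.mem_logNat SD_pos hl3
        have hum : ((u - 2 : ℕ) : ℝ) = (u : ℝ) - 2 := by rw [Nat.cast_sub hu2]; norm_num
        rw [hum] at hla'
        have hup : ((u + 2 : ℕ) : ℝ) = (u : ℝ) + 2 := by push_cast; ring
        rw [hup] at hlb'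
        have hum0 : (0 : ℝ) < (u : ℝ) - 2 := by linarith
        have hlogv : MI.mem SD (Real.log v) (la.span lb) :=
          MI.mem_span hla' hlb' (Real.log_le_log hum0 ht.1) (Real.log_le_log hv0 ht.2)
        have hlogt : MI.mem SD (Real.log t) ((la.span lb).sub (l2.mulInt 140)) := by
          have := MI.mem_sub hlogv (MI.mem_mulInt hl2' 140)
          convert this using 1
          rw [htv, Real.log_div hv0.ne' (by positivity), Real.log_pow]; push_cast; ring
        have h3pi : MI.mem SD ((3 : ℝ) / Real.pi) q := by
          have := MI.mem_divPos SD_pos hq (MI.mem_ofInt SD 3) hpi; simpa using this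
        have hx : MI.mem SD (1 - 3 / Real.pi) ((MI.ofInt SD 1).sub q) := by
          have := MI.mem_sub (MI.mem_ofInt SD 1) h3pi
          have e : ((1 : ℤ) : ℝ) = 1 := Int.cast_one
          rw [e] at this; exact this
        have hlq' := MI.mem_logOneSub SD_pos hlq hx
        have hpi0 : 0 < Real.pi := Real.pi_pos
        have elq : Real.log (1 - (1 - 3 / Real.pi)) = Real.log 3 - Real.log Real.pi := by
          rw [show (1 : ℝ) - (1 - 3 / Real.pi) = 3 / Real.pi by ring, Real.log_div (by norm_num) hpi0.ne']
        rw [elq] at hlq'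
        have hlpi : MI.mem SD (Real.log Real.pi) (l3.sub lq) := by
          have := MI.mem_sub hl3' hlq'
          convert this using 1; push_cast; ring
        have hL : MI.mem SD (Real.log (t / (2 * Real.pi)))
            ((((la.span lb).sub (l2.mulInt 140)).sub l2).sub (l3.sub lq)) := by
          have := MI.mem_sub (MI.mem_sub hlogt hl2') hlpi
          convert this using 1
          rw [Real.log_div ht0.ne' (by positivity), Real.log_mul (by norm_num) hpi0.ne']
          ring
        have htI : MI.mem SD t ⟨((u : ℤ) - 2) * 2 ^ 60, ((u : ℤ) + 2) * 2 ^ 60⟩ := by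
          rw [MI.mem_def, SD_real]
          push_cast
          constructor <;> nlinarith [ht.1, ht.2]
        have hth : MI.mem SD (t / 2) (MI.divNat ⟨((u : ℤ) - 2) * 2 ^ 60, ((u : ℤ) + 2) * 2 ^ 60⟩ 2) :=
          MI.mem_divNat htI (n := 2) (by norm_num)
        set Mv : ℝ := t / 2 * Real.log (t / (2 * Real.pi)) - t / 2 - Real.pi / 8 with hMv
        have hMm : MI.mem SD Mv M := by
          rw [← hM]
          have := MI.mem_sub (MI.mem_sub (MI.mem_mul SD_pos hL hth) hth) (MI.mem_divNat hpi (n := 8) (by norm_num))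
          convert this using 1
          rw [hMv]; ring
        have hK : MI.mem SD (stirlingVertRate (1 / 4))
            (((MI.ofFrac SD 1 6).add (MI.ofFrac SD 5 32)).add (Tl.piI.divNat 12)) := by
          have := MI.mem_add (MI.mem_add (MI.mem_ofFrac SD 1 (q := 6) (by norm_num))
            (MI.mem_ofFrac SD 5 (q := 32) (by norm_num))) (MI.mem_divNat hpi (n := 12) (by norm_num))
          convert this using 1
          unfold stirlingVertRate; push_cast; ring
        set tlo : ℝ := ((((u : ℤ) - 2) * 2 ^ 60 : ℤ) : ℝ) / SD with htlo
        have htlo_pos : 0 < tlo := by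
          rw [htlo, SD_real]; push_cast
          apply div_pos _ (by positivity)
          nlinarith
        have htlo_le : tlo ≤ t := by
          rw [htlo, div_le_iff₀ hSr, SD_real]; push_cast; nlinarith [ht.1]
        have hRm : MI.mem SD (2 * stirlingVertRate (1 / 4) / tlo) R := by
          rw [← hR]
          have := MI.mem_divPos SD_pos hR' (MI.mem_mulInt hK 2) (MI.mem_lower SD_pos _)
          convert this using 1; rw [htlo]; push_cast; ring
        have hK0 : 0 ≤ stirlingVertRate (1 / 4) := by unfold stirlingVertRate; positivity
        have hRt : 2 * stirlingVertRate (1 / 4) / t ≤ 2 * stirlingVertRate (1 / 4) / tlo :=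
          div_le_div_of_nonneg_left (by positivity) htlo_pos htlo_le
        have hdec : 2 * ((M.hi - M.lo) + R.hi) < Tl.piI.lo := of_decide_eq_true hok
        have hdec' : (2 : ℝ) * ((M.hi - M.lo) + R.hi) < Tl.piI.lo := by exact_mod_cast hdec
        have hpilo : (Tl.piI.lo : ℝ) ≤ Real.pi * SD := hpi.1
        have hM1 := hMm.1
        have hM2 := hMm.2
        have hR2 := hRm.2
        have habs : |(M.lo : ℝ) / SD - Mv| * SD ≤ (M.hi : ℝ) - M.lo := by
          rw [abs_sub_comm, abs_of_nonneg (by rw [sub_nonneg, div_le_iff₀ hSr]; exact hM1)]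
          rw [sub_mul, div_mul_cancel₀ _ hSr.ne']
          linarith
        have hRle : 2 * stirlingVertRate (1 / 4) / t * SD ≤ R.hi := by
          have := mul_le_mul_of_nonneg_right hRt hSr.le
          linarith
        have key : (|(M.lo : ℝ) / SD - Mv| + 2 * stirlingVertRate (1 / 4) / t) * SD < Real.pi / 2 * SD := by
          rw [add_mul]; nlinarith
        exact lt_of_mul_lt_mul_right key hSr.le
    · simp at h
  · simp at h

/-! ### The sign test -/

/-- Soundness of `rotSignOk`: if `e ∈ Eφ`, `w ∈ W` (scale `sc`), `d ∈ DB` (scale `SD`) and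
`x/2^sh · SD = r · x · sc` for all `x`, then with `rd = r · d`:
`Re (e (w - i rd)) · sc < -1 ∧ 1 < Re (e (w + i rd)) · sc`, or the mirror image. [folklore] -/
theorem rotSignOk_sound {sc sh : ℕ} (hsc0 : 0 < sc) {r : ℝ}
    (hsc : ∀ x : ℝ, x / (2 ^ sh : ℕ) * SD = r * x * sc) {Eφ W DB : MC}
    (h : rotSignOk sc sh Eφ W DB = true) {e w d : ℂ}
    (he : MC.mem sc e Eφ) (hw : MC.mem sc w W) (hd : MC.mem SD d DB) :
    ((e * (w - r * I * d)).re * sc < -1 ∧ 1 < (e * (w + r * I * d)).re * sc) ∨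
      (1 < (e * (w - r * I * d)).re * sc ∧ (e * (w + r * I * d)).re * sc < -1) := by
  have hdec := of_decide_eq_true h
  have hRD : MC.mem sc ((r : ℂ) * d) ⟨DB.re.divNat (2 ^ sh), DB.im.divNat (2 ^ sh)⟩ := by
    have hre : ((r : ℂ) * d).re = r * d.re := by simp
    have him : ((r : ℂ) * d).im = r * d.im := by simp
    constructor
    · have := MI.mem_divNat hd.1 (n := 2 ^ sh) (by positivity)
      refine MI.mem_of_mul_eq this ?_
      rw [hsc, hre]
    · have := MI.mem_divNat hd.2 (n := 2 ^ sh) (by positivity)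
      refine MI.mem_of_mul_eq this ?_
      rw [hsc, him]
  have hrdI := MC.mem_mulI hRD
  have hm : MC.mem sc (w - r * I * d) (W.sub (MC.mulI ⟨DB.re.divNat (2 ^ sh), DB.im.divNat (2 ^ sh)⟩)) := by
    have := MC.mem_sub hw hrdI; convert this using 1; ring
  have hp : MC.mem sc (w + r * I * d) (W.add (MC.mulI ⟨DB.re.divNat (2 ^ sh), DB.im.divNat (2 ^ sh)⟩)) := by
    have := MC.mem_add hw hrdI; convert this using 1; ring
  have hP1 := (MC.mem_mul hsc0 he hm).1
  have hP2 := (MC.mem_mul hsc0 he hp).1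
  rw [MI.mem_def] at hP1 hP2
  rcases hdec with ⟨h1, h2⟩ | ⟨h1, h2⟩
  · left
    have h1' : ((MC.mul sc Eφ (W.sub (MC.mulI ⟨DB.re.divNat (2 ^ sh), DB.im.divNat (2 ^ sh)⟩))).re.hi : ℝ) < -1 := by
      exact_mod_cast h1
    have h2' : (1 : ℝ) < (MC.mul sc Eφ (W.add (MC.mulI ⟨DB.re.divNat (2 ^ sh), DB.im.divNat (2 ^ sh)⟩))).re.lo := by
      exact_mod_cast h2
    exact ⟨by linarith [hP1.2], by linarith [hP2.1]⟩
  · right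
    have h1' : (1 : ℝ) < (MC.mul sc Eφ (W.sub (MC.mulI ⟨DB.re.divNat (2 ^ sh), DB.im.divNat (2 ^ sh)⟩))).re.lo := by
      exact_mod_cast h1
    have h2' : ((MC.mul sc Eφ (W.add (MC.mulI ⟨DB.re.divNat (2 ^ sh), DB.im.divNat (2 ^ sh)⟩))).re.hi : ℝ) < -1 := by
      exact_mod_cast h2
    exact ⟨by linarith [hP1.1], by linarith [hP2.2]⟩

/-- From the rotated sign conditions at scale `sc` with `E · sc ≤ 1` to the hypotheses of
`hardyZ_mul_hardyZ_neg_of_center`, and hence to `Z(t₀ - r) Z(t₀ + r) < 0`. [folklore] -/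
lemma sign_of_rot {sc : ℕ} (hsc0 : 0 < sc) {t0 r φ : ℝ} (h8 : 8 ≤ t0) (hr : 0 < r) (hr1 : r ≤ 1 / 2 ^ 60)
    (hφ₁ : |φ - riemannSiegelTheta (t0 - r)| < Real.pi / 2) (hφ₂ : |φ - riemannSiegelTheta (t0 + r)| < Real.pi / 2)
    (hE : 2 * (t0 + 15) ^ 3 * r ^ 2 * sc ≤ 1) {e w d : ℂ} (he : e = cexp (φ * I))
    (hw : w = riemannZeta (1 / 2 + t0 * I)) (hd : d = deriv riemannZeta (1 / 2 + t0 * I))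
    (hrs : ((e * (w - r * I * d)).re * sc < -1 ∧ 1 < (e * (w + r * I * d)).re * sc) ∨
      (1 < (e * (w - r * I * d)).re * sc ∧ (e * (w + r * I * d)).re * sc < -1)) :
    hardyZ (t0 - r) * hardyZ (t0 + r) < 0 := by
  have hSr : (0 : ℝ) < sc := by exact_mod_cast hsc0
  set E : ℝ := 2 * (t0 + 15) ^ 3 * r ^ 2 with hEdef
  have hE1 : E ≤ 1 / sc := by rw [le_div_iff₀ hSr]; exact hE
  subst he hw hd
  exact hardyZ_mul_hardyZ_neg_of_center h8 hr (hr1.trans (by norm_num)) hφ₁ hφ₂ (by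
    rcases hrs with ⟨h1, h2⟩ | ⟨h1, h2⟩
    · left
      constructor
      · have key := (lt_div_iff₀ hSr).2 h1
        rw [neg_div] at key
        linarith
      · have key := (div_lt_iff₀ hSr).2 h2
        linarith
    · right
      constructor
      · have key := (div_lt_iff₀ hSr).2 h1
        linarith
      · have key := (lt_div_iff₀ hSr).2 h2
        rw [neg_div] at key
        linarith)

/-- Grid bookkeeping: for `t0 = c/A`, `A = 2^140 · B` (`B = 2^e`), `u = c / B` (in `ℕ`):
`u/2^140 ≤ t0 ≤ u/2^140 + 2^{-140}`. [folklore] -/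
lemma grid_bounds {c e : ℕ} :
    ((c / 2 ^ e : ℕ) : ℝ) / 2 ^ 140 ≤ (c : ℝ) / (2 ^ 140 * 2 ^ e) ∧
      (c : ℝ) / (2 ^ 140 * 2 ^ e) ≤ ((c / 2 ^ e : ℕ) : ℝ) / 2 ^ 140 + 1 / 2 ^ 140 := by
  set u : ℕ := c / 2 ^ e with hu
  have hb0 : 0 < 2 ^ e := pow_pos (by norm_num) _
  have hu1 : u * 2 ^ e ≤ c := by rw [hu]; exact Nat.div_mul_le_self c _
  have hu2 : c < (u + 1) * 2 ^ e := by rw [hu, mul_comm]; exact Nat.lt_mul_div_succ c hb0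
  have hB : (0 : ℝ) < 2 ^ 140 := pow_pos (by norm_num) _
  have hB' : (0 : ℝ) < 2 ^ e := pow_pos (by norm_num) _
  have hu1r : (u : ℝ) * 2 ^ e ≤ c := by exact_mod_cast hu1
  have hu2r : (c : ℝ) < ((u : ℝ) + 1) * 2 ^ e := by exact_mod_cast hu2
  constructor
  · rw [div_le_div_iff₀ hB (by positivity)]
    nlinarith
  · have e1 : ((u : ℝ)) / 2 ^ 140 + 1 / 2 ^ 140 = (((u : ℝ) + 1) * 2 ^ e) / (2 ^ 140 * 2 ^ e) := by
      field_simp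
    rw [e1]
    exact div_le_div_of_nonneg_right hu2r.le (by positivity)

/-! ### Heavy zeros -/

/-- Soundness of `termsOfHi`: for every `γ` in the bracket `[(c-16)/2^CB, (c+16)/2^CB]` (with
`0 ≤ γ ≤ T₀`) whose derivative lies in `DB` (low scale), the summands at `y₊`, `y₋` are bounded by
`lo/S`, `hi/S`. [folklore] -/
theorem termsOfHi_sound {Th : Tables} (hT : Th.Valid) (hTS : Th.S = S D) {c : ℕ} {DB : MC}
    {vlo vhi : ℤ} (h : termsOfHi D Th c DB = some (vlo, vhi)) {γ : ℝ}
    (hγ : γ ∈ Set.Icc (((c : ℝ) - 16) / 2 ^ CB D) (((c : ℝ) + 16) / 2 ^ CB D)) (hγ0 : 0 ≤ γ)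
    (hγT : γ ≤ T0N) (hD : MC.mem SD (deriv riemannZeta (1 / 2 + γ * I)) DB) :
    (vlo : ℝ) ≤ term D.yPlus γ * Th.S ∧ term D.yMinus γ * Th.S ≤ vhi := by
  have hA : (0 : ℝ) < 2 ^ CB D := pow_pos (by norm_num) _
  have hTS2 : Th.S = 2 ^ (FP D).sb := by rw [hTS]; rfl
  have hS := hT.S_pos
  unfold termsOfHi at h
  simp only at h
  split at h
  · simp at h
  · rename_i g hg
    split at h
    · rename_i FP' FM hFP hFM
      simp only [Option.some.injEq, Prod.mk.injEq] at h
      obtain ⟨rfl, rfl⟩ := h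
      have hG : MI.mem Th.S γ ⟨((c : ℤ) - 16) * 2 ^ 76, ((c : ℤ) + 16) * 2 ^ 76⟩ := by
        rw [MI.mem_def, hTS, S_real]
        push_cast
        obtain ⟨h1, h2⟩ := hγ
        rw [div_le_iff₀ hA] at h1
        rw [le_div_iff₀ hA] at h2
        have h76 : (0 : ℝ) ≤ 2 ^ 76 := by positivity
        constructor
        · have := mul_le_mul_of_nonneg_right h1 h76; linarith
        · have := mul_le_mul_of_nonneg_right h2 h76; linarith
      have hDBS : MC.mem Th.S (deriv riemannZeta (1 / 2 + γ * I)) ⟨MI.rescale SD Th.S DB.re, MI.rescale SD Th.S DB.im⟩ :=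
        ⟨MI.mem_rescale SD_pos Th.S hD.1, MI.mem_rescale SD_pos Th.S hD.2⟩
      have hρ : MC.mem Th.S ((1 / 2 : ℂ) + γ * I) ⟨halfAt Th.S, ⟨((c : ℤ) - 16) * 2 ^ 76, ((c : ℤ) + 16) * 2 ^ 76⟩⟩ := by
        constructor
        · have := MI.mem_ofFrac Th.S 1 (q := 2) (by norm_num)
          simp only [halfAt]
          convert this using 1; simp
        · simpa using hG
      have hDen := MC.mem_mul hS hρ hDBS
      have hgm := mem_kernelBox hT hTS2 hg hG hγ0 hγT
      have hP := mem_termBox hT hTS2 hFP hG hgm hDen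
      have hM := mem_termBox hT hTS2 hFM hG hgm hDen
      constructor
      · have := hP.1; rw [term_eq]; exact this
      · have := hM.2; rw [term_eq]; exact this
    · simp at h

/-- `E · S ≤ 1` for the Taylor error `E = 2(t₀+15)³ r²`, `t₀ ≤ 5000`, `r = 16/2^CB`,
`S = 2^CB · 2^76`. [folklore] -/
lemma errE_mul_S_le {t : ℝ} (ht0 : 0 ≤ t) (ht : t ≤ 5000) :
    2 * (t + 15) ^ 3 * radH D ^ 2 * S D ≤ 1 := by
  have hA : (0 : ℝ) < 2 ^ CB D := pow_pos (by norm_num) _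
  have hcube : (t + 15) ^ 3 ≤ 2 ^ 37 := by
    calc (t + 15) ^ 3 ≤ (5015 : ℝ) ^ 3 := pow_le_pow_left₀ (by linarith) (by linarith) 3
      _ ≤ 2 ^ 37 := by norm_num
  set X : ℝ := 2 ^ CB D with hX
  set Y : ℝ := 2 ^ 76 with hY
  have hY84 : (16 : ℝ) ^ 2 * Y = 2 ^ 84 := by rw [hY]; norm_num
  have e : 2 * (t + 15) ^ 3 * radH D ^ 2 * S D = 2 * (t + 15) ^ 3 * 2 ^ 84 / X := by
    unfold radH; rw [S_real, ← hX, ← hY, ← hY84]; field_simp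
  rw [e, div_le_one hA]
  calc 2 * (t + 15) ^ 3 * (2 : ℝ) ^ 84 ≤ 2 * 2 ^ 37 * 2 ^ 84 := by nlinarith [pow_pos (show (0:ℝ) < 2 by norm_num) 84]
    _ = 2 ^ 122 := by norm_num
    _ ≤ X := by rw [hX]; exact pow_le_pow_right₀ (by norm_num) (le_trans (by norm_num) le_CB)

/-- **Soundness of the heavy-zero computation.** With `t₀ = c/2^CB`, `8 ≤ t₀ - r`, `t₀ + r < T₀`:
a passed `hiCheck` certifies `Z(t₀ - r) Z(t₀ + r) < 0` and bounds the summands at `y₊`, `y₋` by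
`lo/S`, `hi/S` for every `γ` in the bracket. [folklore] -/
theorem hiCheck_sound {Th Tl : Tables} (hTh : Th.Valid) (hThS : Th.S = S D) (hTl : Tl.Valid)
    (hTlS : Tl.S = SD) {νT : ℕ} {c : ℕ} (hc8 : 8 * 2 ^ CB D + 16 ≤ c) (hcT : c + 16 < T0N * 2 ^ CB D)
    {vlo vhi : ℤ} (h : hiCheck D Th Tl νT c = some (vlo, vhi)) :
    hardyZ ((c : ℝ) / 2 ^ CB D - radH D) * hardyZ ((c : ℝ) / 2 ^ CB D + radH D) < 0 ∧
      ∀ γ ∈ Set.Icc ((c : ℝ) / 2 ^ CB D - radH D) ((c : ℝ) / 2 ^ CB D + radH D),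
        (vlo : ℝ) ≤ term D.yPlus γ * Th.S ∧ term D.yMinus γ * Th.S ≤ vhi := by
  set A : ℝ := 2 ^ CB D with hAdef
  have hA : 0 < A := pow_pos (by norm_num) _
  set t0 : ℝ := (c : ℝ) / A with ht0def
  have hrad : radH D = 16 / A := rfl
  have hc8r : (8 : ℝ) * A + 16 ≤ c := by rw [hAdef]; exact_mod_cast hc8
  have hcTr : (c : ℝ) + 16 < T0N * A := by rw [hAdef]; exact_mod_cast hcT
  have ht0m : 8 ≤ t0 - radH D := by rw [ht0def, hrad, ← sub_div, le_div_iff₀ hA]; linarith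
  have ht0p : t0 + radH D < T0N := by rw [ht0def, hrad, ← add_div, div_lt_iff₀ hA]; linarith
  have hT0 : (T0N : ℝ) = 5000 := T0N_real
  have h8t0 : 8 ≤ t0 := by linarith [radH_pos (D := D)]
  have hS := hTh.S_pos
  -- the grid point `u`
  set u : ℕ := uOfHi D c with hudef
  have hB : (0 : ℝ) < 2 ^ 140 := pow_pos (by norm_num) _
  have hpowCB : 2 ^ 140 * 2 ^ (CB D - 140) = 2 ^ CB D := CB_split
  have hb0 : 0 < 2 ^ (CB D - 140) := pow_pos (by norm_num) _
  have hu8 : 8 * 2 ^ 140 ≤ u := by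
    rw [hudef]; unfold uOfHi
    rw [Nat.le_div_iff_mul_le hb0, mul_assoc, hpowCB]
    omega
  have huT : u < T0N * 2 ^ 140 := by
    rw [hudef]; unfold uOfHi
    rw [Nat.div_lt_iff_lt_mul hb0, mul_assoc, hpowCB]
    omega
  have hAB : A = 2 ^ 140 * 2 ^ (CB D - 140) := by rw [hAdef]; exact twoCB_real
  have hgb := grid_bounds (c := c) (e := CB D - 140)
  rw [← hAB] at hgb
  obtain ⟨hgrid1, hgrid2⟩ := hgb
  have hgrid : |t0 - (u : ℝ) / 2 ^ 140| ≤ 1 / 2 ^ 140 := by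
    have e : (u : ℝ) = ((c / 2 ^ (CB D - 140) : ℕ) : ℝ) := by rw [hudef]; rfl
    rw [e, ht0def, abs_le]; constructor <;> linarith [show (0:ℝ) < 1 / 2 ^ 140 by positivity]
  have hγu : ∀ γ ∈ Set.Icc (t0 - radH D) (t0 + radH D), |γ - (u : ℝ) / 2 ^ 140| ≤ 1 / 2 ^ 60 := by
    intro γ hγ
    have h1 : |γ - t0| ≤ radH D := by rw [abs_le]; constructor <;> linarith [hγ.1, hγ.2]
    have h140_60 : (1 : ℝ) / 2 ^ 140 + 1 / 2 ^ 64 ≤ 1 / 2 ^ 60 := by norm_num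
    calc |γ - (u : ℝ) / 2 ^ 140| = |(γ - t0) + (t0 - (u : ℝ) / 2 ^ 140)| := by ring_nf
      _ ≤ |γ - t0| + |t0 - (u : ℝ) / 2 ^ 140| := abs_add_le _ _
      _ ≤ 1 / 2 ^ 60 := by linarith [radH_le (D := D)]
  have hends : ∀ t ∈ Set.Icc (t0 - radH D) (t0 + radH D), (u : ℝ) - 2 ≤ t * 2 ^ 140 ∧ t * 2 ^ 140 ≤ (u : ℝ) + 2 := by
    intro t ht
    have hr140 : radH D * 2 ^ 140 ≤ 1 := by
      rw [hrad, div_mul_eq_mul_div, div_le_one hA, hAdef]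
      calc (16 : ℝ) * 2 ^ 140 = 2 ^ 144 := by norm_num
        _ ≤ 2 ^ CB D := pow_le_pow_right₀ (by norm_num) (le_trans (by norm_num) le_CB)
    have hg1 : (u : ℝ) ≤ t0 * 2 ^ 140 := by
      have := mul_le_mul_of_nonneg_right hgrid1 hB.le
      rw [div_mul_cancel₀ _ hB.ne'] at this; rw [ht0def]; exact this
    have hg2 : t0 * 2 ^ 140 ≤ (u : ℝ) + 1 := by
      have := mul_le_mul_of_nonneg_right hgrid2 hB.le
      rw [add_mul, div_mul_cancel₀ _ hB.ne', div_mul_cancel₀ _ hB.ne'] at this; rw [ht0def]; exact this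
    constructor
    · have := mul_le_mul_of_nonneg_right ht.1 hB.le
      rw [sub_mul] at this; linarith
    · have := mul_le_mul_of_nonneg_right ht.2 hB.le
      rw [add_mul] at this; linarith
  unfold hiCheck at h
  split at h
  · rename_i W DB M R hW hDB hMR
    split at h
    · rename_i Eφ hEφ
      split_ifs at h with hcond
      obtain ⟨hstir, hrot⟩ := hcond
      have hs0 : (1 / 2 : ℂ) + t0 * I ≠ 1 := fun h ↦ by
        have := congrArg Complex.im h; simp at this; linarith
      have hin : MC.mem Th.S (1 / 2 + t0 * I) ⟨halfAt Th.S, MI.ofScaled ((c : ℤ) * 2 ^ 76)⟩ := by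
        apply mem_input hS
        rw [ht0def, hAdef, hThS, S_real, Int.cast_mul, Int.cast_pow, Int.cast_natCast, Int.cast_ofNat,
          mul_div_mul_right _ _ (by positivity : (2 : ℝ) ^ 76 ≠ 0)]
      have hWm := mem_zetaBall hTh hin hs0 hW
      have hD0 := mem_derivBox hTl hTlS hu8 huT hDB (γ := t0)
        (by calc |t0 - (u:ℝ)/2^140| ≤ 1/2^140 := hgrid
              _ ≤ 1 / 2 ^ 60 := by norm_num)
      set φ : ℝ := (M.lo : ℝ) / SD with hφdef
      have hφS : φ = (((M.lo * 2 ^ (SB D - 200) : ℤ)) : ℝ) / Th.S := by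
        rw [hφdef, hThS, S_real', SD_real']; push_cast; field_simp
      have hpiH : MI.mem (2 ^ SB D) Real.pi Th.piI := by rw [← S_eq, ← hThS]; exact hTh.mem_pi
      have hE : MC.mem Th.S (cexp (φ * I)) Eφ := by
        have hθ : MI.mem (2 ^ SB D) φ (MI.ofScaled (M.lo * 2 ^ (SB D - 200))) := by
          rw [← S_eq, ← hThS, hφS]; exact MI.mem_ofScaled hS _
        have := MC.mem_expIFast hpiH hEφ hθ
        rw [← S_eq, ← hThS] at this; simpa using this
      have hφ₁ : |φ - riemannSiegelTheta (t0 - radH D)| < Real.pi / 2 :=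
        abs_sub_riemannSiegelTheta_lt_of_stirling (by linarith)
          (stirling_sound hTl hTlS hu8 hMR hstir (hends _ ⟨le_rfl, by linarith [radH_pos (D := D)]⟩))
      have hφ₂ : |φ - riemannSiegelTheta (t0 + radH D)| < Real.pi / 2 :=
        abs_sub_riemannSiegelTheta_lt_of_stirling (by linarith [radH_pos (D := D)])
          (stirling_sound hTl hTlS hu8 hMR hstir (hends _ ⟨by linarith [radH_pos (D := D)], le_rfl⟩))
      have hsc : ∀ x : ℝ, x / (2 ^ 120 : ℕ) * SD = radH D * x * Th.S := fun x ↦ by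
        rw [SD_real', hThS, S_real, hrad, hAdef]
        have e1 : (2 : ℝ) ^ 200 = 2 ^ 120 * 2 ^ 80 := by rw [← pow_add]
        have e2 : (16 : ℝ) * 2 ^ 76 = 2 ^ 80 := by rw [show (16 : ℝ) = 2 ^ 4 by norm_num, ← pow_add]
        have h120 : (2 : ℝ) ^ 120 ≠ 0 := by positivity
        have hCB0 : (2 : ℝ) ^ CB D ≠ 0 := by positivity
        rw [Nat.cast_pow, Nat.cast_ofNat, e1, ← mul_assoc, div_mul_cancel₀ _ h120, ← e2]
        field_simp
      have hrs := rotSignOk_sound hS hsc hrot hE hWm hD0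
      have hES : 2 * (t0 + 15) ^ 3 * radH D ^ 2 * Th.S ≤ 1 := by
        rw [hThS]; exact errE_mul_S_le (D := D) (t := t0) (by linarith) (by linarith [radH_pos (D := D)])
      have hsign := sign_of_rot hS h8t0 radH_pos (radH_le.trans (by norm_num)) hφ₁ hφ₂ hES rfl rfl rfl hrs
      refine ⟨hsign, fun γ hγ ↦ ?_⟩
      have hγ0 : 0 ≤ γ := by linarith [hγ.1]
      have hγT : γ ≤ T0N := by linarith [hγ.2]
      have hDγ := mem_derivBox hTl hTlS hu8 huT hDB (hγu γ hγ)
      have hγ' : γ ∈ Set.Icc (((c : ℝ) - 16) / 2 ^ CB D) (((c : ℝ) + 16) / 2 ^ CB D) := by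
        rw [← hAdef, sub_div, add_div, ← ht0def, ← hrad]; exact hγ
      exact termsOfHi_sound hTh hThS h hγ' hγ0 hγT hDγ
    · simp at h
  · simp at h

/-! ### Light zeros -/

/-- Soundness of `weightBound`: `2|gv|/|w| ≤ wB/2^60` for `gv ∈ g`, `w ∈ Den` (scale `SD`). [folklore] -/
theorem weightBound_sound {g : MI} {Den : MC} {wB : ℕ} (h : weightBound g Den = some wB) {gv : ℝ}
    (hg : MI.mem SD gv g) {w : ℂ} (hw : MC.mem SD w Den) :
    w ≠ 0 ∧ 2 * |gv| / ‖w‖ ≤ (wB : ℝ) / 2 ^ 60 := by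
  unfold weightBound at h
  simp only at h
  split_ifs at h with hq
  simp only [Option.some.injEq] at h
  set q : ℕ := MC.normLo Den with hqdef
  have hq0 : 0 < q := Nat.pos_of_ne_zero hq
  have hqr : (0 : ℝ) < q := by exact_mod_cast hq0
  have hSr : (0 : ℝ) < SD := by exact_mod_cast SD_pos
  have hql : (q : ℝ) ≤ ‖w‖ * SD := MC.normLo_le hw
  have hw0 : 0 < ‖w‖ := by
    by_contra h0; push Not at h0
    have : ‖w‖ * SD ≤ 0 := mul_nonpos_of_nonpos_of_nonneg h0 hSr.le
    linarith
  have hwne : w ≠ 0 := norm_pos_iff.1 hw0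
  refine ⟨hwne, ?_⟩
  have hga : |gv| * SD ≤ (MI.absHi g : ℝ) := MI.abs_le_absHi hg
  have habs0 : 0 ≤ MI.absHi g := by unfold MI.absHi; exact le_max_of_le_left (abs_nonneg _)
  have hgaN : (((MI.absHi g).toNat : ℕ) : ℤ) = MI.absHi g := Int.toNat_of_nonneg habs0
  set K : ℕ := 2 * (MI.absHi g).toNat * 2 ^ 60 with hK
  have hwB : (K : ℝ) / q ≤ wB := by
    rw [← h]
    have := (nat_fdiv_bounds K hq0).2
    have e : (((K / q : ℕ) + 1 : ℕ) : ℝ) = ((K / q : ℕ) : ℝ) + 1 := by push_cast; ring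
    rw [e]; linarith
  have hgaR : (((MI.absHi g).toNat : ℕ) : ℝ) = (MI.absHi g : ℝ) := by exact_mod_cast hgaN
  have hKr : (K : ℝ) = 2 * (MI.absHi g : ℝ) * 2 ^ 60 := by
    rw [hK]; push_cast; rw [hgaR]; norm_num
  have h1 : 2 * |gv| / ‖w‖ ≤ 2 * (MI.absHi g : ℝ) / q := by
    rw [div_le_div_iff₀ hw0 hqr]
    have := mul_le_mul hga hql (by positivity) (by positivity)
    nlinarith [this]
  calc 2 * |gv| / ‖w‖ ≤ 2 * (MI.absHi g : ℝ) / q := h1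
    _ = (K : ℝ) / q / 2 ^ 60 := by rw [hKr]; field_simp
    _ ≤ (wB : ℝ) / 2 ^ 60 := div_le_div_of_nonneg_right hwB (by positivity)

/-- `E · SD ≤ 1` for the Taylor error of the light sign test: `t ≤ 5000`, `r = 2^{-150}`. [folklore] -/
lemma errE_mul_SD_le {t : ℝ} (ht0 : 0 ≤ t) (ht : t ≤ 5000) :
    2 * (t + 15) ^ 3 * radL ^ 2 * SD ≤ 1 := by
  have hcube : (t + 15) ^ 3 ≤ 2 ^ 37 := by
    calc (t + 15) ^ 3 ≤ (5015 : ℝ) ^ 3 := pow_le_pow_left₀ (by linarith) (by linarith) 3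
      _ ≤ 2 ^ 37 := by norm_num
  have hr : radL ^ 2 * SD = 1 / 2 ^ 100 := by
    rw [radL_eq, SD_real', div_pow, one_pow, ← pow_mul, show (150 * 2 : ℕ) = 100 + 200 by norm_num, pow_add]
    have h1 : (2 : ℝ) ^ 100 ≠ 0 := by positivity
    have h2 : (2 : ℝ) ^ 200 ≠ 0 := by positivity
    field_simp
  have h100 : (0 : ℝ) < 2 ^ 100 := by positivity
  calc 2 * (t + 15) ^ 3 * radL ^ 2 * SD = 2 * (t + 15) ^ 3 * (radL ^ 2 * SD) := by ring
    _ = 2 * (t + 15) ^ 3 / 2 ^ 100 := by rw [hr]; ring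
    _ ≤ 2 * 2 ^ 37 / 2 ^ 100 := by gcongr
    _ ≤ 1 := by
      rw [div_le_one h100]
      calc (2 : ℝ) * 2 ^ 37 = 2 ^ 38 := by norm_num
        _ ≤ 2 ^ 100 := pow_le_pow_right₀ (by norm_num) (by norm_num)

/-- `SD = 2^200` in `ℕ`. [folklore] -/
lemma SD_eq200 : SD = 2 ^ 200 := SD_eq_PL

/-- **Soundness of the light-zero computation.** With `t = cl/2^160`, `8 ≤ t - r`, `t + r < T₀`
(`r = 2^{-150}`): a passed `lightCheck` certifies `Z(t - r) Z(t + r) < 0` and `|F_y(γ)| ≤ wB/2^60`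
for every `γ` in the bracket and every real `y`. [folklore] -/
theorem lightCheck_sound {Tl : Tables} (hTl : Tl.Valid) (hTlS : Tl.S = SD) {cl : ℕ}
    (hc8 : 8 * 2 ^ CL + 2 ^ 10 ≤ cl) (hcT : cl + 2 ^ 10 < T0N * 2 ^ CL) {wB : ℕ}
    (h : lightCheck Tl cl = some wB) :
    hardyZ ((cl : ℝ) / 2 ^ CL - radL) * hardyZ ((cl : ℝ) / 2 ^ CL + radL) < 0 ∧
      ∀ γ ∈ Set.Icc ((cl : ℝ) / 2 ^ CL - radL) ((cl : ℝ) / 2 ^ CL + radL), ∀ y : ℝ,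
        |term y γ| ≤ (wB : ℝ) / 2 ^ 60 := by
  obtain ⟨Q, hQ⟩ : ∃ Q : ℕ, 2 ^ CL = Q := ⟨_, rfl⟩
  set A : ℝ := 2 ^ CL with hAdef
  have hA : 0 < A := pow_pos (by norm_num) _
  have hAQ : A = (Q : ℝ) := by rw [hAdef, ← hQ]; push_cast; rfl
  set t0 : ℝ := (cl : ℝ) / A with ht0def
  have hrad : radL = 2 ^ 10 / A := rfl
  rw [hQ] at hc8 hcT
  have hc8r : (8 : ℝ) * A + 2 ^ 10 ≤ cl := by rw [hAQ]; exact_mod_cast hc8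
  have hcTr : (cl : ℝ) + 2 ^ 10 < T0N * A := by rw [hAQ]; exact_mod_cast hcT
  have ht0m : 8 ≤ t0 - radL := by rw [ht0def, hrad, ← sub_div, le_div_iff₀ hA]; linarith
  have ht0p : t0 + radL < T0N := by rw [ht0def, hrad, ← add_div, div_lt_iff₀ hA]; linarith
  have hT0 : (T0N : ℝ) = 5000 := T0N_real
  have h8t0 : 8 ≤ t0 := by linarith [radL_pos]
  set u : ℕ := uOfLo cl with hudef
  have hB : (0 : ℝ) < 2 ^ 140 := pow_pos (by norm_num) _
  have hpow : 2 ^ 140 * 2 ^ 20 = Q := by rw [← hQ, CL_eq, ← pow_add]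
  have hb0 : 0 < 2 ^ 20 := pow_pos (by norm_num) _
  have hu8 : 8 * 2 ^ 140 ≤ u := by
    rw [hudef]; unfold uOfLo
    rw [Nat.le_div_iff_mul_le hb0, mul_assoc, hpow]
    omega
  have huT : u < T0N * 2 ^ 140 := by
    rw [hudef]; unfold uOfLo
    rw [Nat.div_lt_iff_lt_mul hb0, mul_assoc, hpow]
    omega
  have hAB : A = 2 ^ 140 * 2 ^ 20 := by rw [hAdef, CL_eq, ← pow_add]
  have hgb := grid_bounds (c := cl) (e := 20)
  rw [← hAB] at hgb
  obtain ⟨hgrid1, hgrid2⟩ := hgb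
  have hgrid : |t0 - (u : ℝ) / 2 ^ 140| ≤ 1 / 2 ^ 140 := by
    have e : (u : ℝ) = ((cl / 2 ^ 20 : ℕ) : ℝ) := by rw [hudef]; rfl
    rw [e, ht0def, abs_le]; constructor <;> linarith [show (0:ℝ) < 1 / 2 ^ 140 by positivity]
  have hrL : radL ≤ 1 / 2 ^ 64 := by rw [radL_eq]; norm_num
  have hγu : ∀ γ ∈ Set.Icc (t0 - radL) (t0 + radL), |γ - (u : ℝ) / 2 ^ 140| ≤ 1 / 2 ^ 60 := by
    intro γ hγ
    have h1 : |γ - t0| ≤ radL := by rw [abs_le]; constructor <;> linarith [hγ.1, hγ.2]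
    have h140_60 : (1 : ℝ) / 2 ^ 140 + 1 / 2 ^ 64 ≤ 1 / 2 ^ 60 := by norm_num
    calc |γ - (u : ℝ) / 2 ^ 140| = |(γ - t0) + (t0 - (u : ℝ) / 2 ^ 140)| := by ring_nf
      _ ≤ |γ - t0| + |t0 - (u : ℝ) / 2 ^ 140| := abs_add_le _ _
      _ ≤ 1 / 2 ^ 60 := by linarith
  have hends : ∀ t ∈ Set.Icc (t0 - radL) (t0 + radL), (u : ℝ) - 2 ≤ t * 2 ^ 140 ∧ t * 2 ^ 140 ≤ (u : ℝ) + 2 := by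
    intro t ht
    have hr140 : radL * 2 ^ 140 ≤ 1 := by rw [radL_eq]; norm_num
    have hg1 : (u : ℝ) ≤ t0 * 2 ^ 140 := by
      have := mul_le_mul_of_nonneg_right hgrid1 hB.le
      rw [div_mul_cancel₀ _ hB.ne'] at this; rw [ht0def]; exact this
    have hg2 : t0 * 2 ^ 140 ≤ (u : ℝ) + 1 := by
      have := mul_le_mul_of_nonneg_right hgrid2 hB.le
      rw [add_mul, div_mul_cancel₀ _ hB.ne', div_mul_cancel₀ _ hB.ne'] at this; rw [ht0def]; exact this
    constructor
    · have := mul_le_mul_of_nonneg_right ht.1 hB.le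
      rw [sub_mul] at this; linarith
    · have := mul_le_mul_of_nonneg_right ht.2 hB.le
      rw [add_mul] at this; linarith
  unfold lightCheck at h
  split at h
  · rename_i W DB M R hW hDB hMR
    split at h
    · rename_i Eφ hEφ
      split_ifs at h with hcond
      obtain ⟨hstir, hrot⟩ := hcond
      have hs0 : (1 / 2 : ℂ) + t0 * I ≠ 1 := fun h ↦ by
        have := congrArg Complex.im h; simp at this; linarith
      have hin : MC.mem Tl.S (1 / 2 + t0 * I) ⟨halfAt SD, MI.ofScaled ((cl : ℤ) * 2 ^ 40)⟩ := by
        rw [hTlS]; apply mem_input SD_pos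
        rw [ht0def, hAdef, CL_eq, SD_real']
        have e : (2 : ℝ) ^ 200 = 2 ^ 160 * 2 ^ 40 := by rw [← pow_add]
        rw [e, Int.cast_mul, Int.cast_pow, Int.cast_natCast, Int.cast_ofNat,
          mul_div_mul_right _ _ (by positivity : (2 : ℝ) ^ 40 ≠ 0)]
      have hWm := mem_zetaBoxFast hTl hin hs0 hW
      rw [hTlS] at hWm
      have hD0 := mem_derivBox hTl hTlS hu8 huT hDB (γ := t0)
        (by calc |t0 - (u:ℝ)/2^140| ≤ 1/2^140 := hgrid
              _ ≤ 1 / 2 ^ 60 := by norm_num)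
      set φ : ℝ := (M.lo : ℝ) / SD with hφdef
      have hpiL : MI.mem (2 ^ 200) Real.pi Tl.piI := by
        have := hTl.mem_pi; rw [hTlS, SD_eq200] at this; exact this
      have hE : MC.mem SD (cexp (φ * I)) Eφ := by
        have hθ : MI.mem (2 ^ 200) φ (MI.ofScaled M.lo) := by
          rw [← SD_eq200, hφdef]; exact MI.mem_ofScaled SD_pos _
        have := MC.mem_expIFast (sb := 200) hpiL hEφ hθ
        rw [← SD_eq200] at this; simpa using this
      have hφ₁ : |φ - riemannSiegelTheta (t0 - radL)| < Real.pi / 2 :=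
        abs_sub_riemannSiegelTheta_lt_of_stirling (by linarith)
          (stirling_sound hTl hTlS hu8 hMR hstir (hends _ ⟨le_rfl, by linarith [radL_pos]⟩))
      have hφ₂ : |φ - riemannSiegelTheta (t0 + radL)| < Real.pi / 2 :=
        abs_sub_riemannSiegelTheta_lt_of_stirling (by linarith [radL_pos])
          (stirling_sound hTl hTlS hu8 hMR hstir (hends _ ⟨by linarith [radL_pos], le_rfl⟩))
      have hsc : ∀ x : ℝ, x / (2 ^ 150 : ℕ) * SD = radL * x * SD := fun x ↦ by
        rw [radL_eq]; push_cast; ring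
      have hrs := rotSignOk_sound SD_pos hsc hrot hE hWm hD0
      have hES := errE_mul_SD_le (t := t0) (by linarith) (by linarith [radL_pos])
      have hsign := sign_of_rot SD_pos h8t0 radL_pos (hrL.trans (by norm_num)) hφ₁ hφ₂ hES rfl rfl rfl hrs
      refine ⟨hsign, fun γ hγ y ↦ ?_⟩
      -- the weight bound
      dsimp only at h
      split at h
      · simp at h
      · rename_i g hg
        have hγ0 : 0 ≤ γ := by linarith [hγ.1]
        have hγT : γ ≤ T0N := by linarith [hγ.2]
        have hDγ := mem_derivBox hTl hTlS hu8 huT hDB (hγu γ hγ)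
        have hG : MI.mem SD γ ⟨((cl : ℤ) - 2 ^ 10) * 2 ^ 40, ((cl : ℤ) + 2 ^ 10) * 2 ^ 40⟩ := by
          rw [MI.mem_def, SD_real']
          have e : (2 : ℝ) ^ 200 = A * 2 ^ 40 := by rw [hAdef, CL_eq, ← pow_add]
          rw [e]
          push_cast
          obtain ⟨h1, h2⟩ := hγ
          rw [ht0def, hrad, ← sub_div, div_le_iff₀ hA] at h1
          rw [ht0def, hrad, ← add_div, le_div_iff₀ hA] at h2
          have h40 : (0 : ℝ) ≤ 2 ^ 40 := by positivity
          constructor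
          · have := mul_le_mul_of_nonneg_right h1 h40; linarith
          · have := mul_le_mul_of_nonneg_right h2 h40; linarith
        have hρ : MC.mem SD ((1 / 2 : ℂ) + γ * I) ⟨halfAt SD, ⟨((cl : ℤ) - 2 ^ 10) * 2 ^ 40, ((cl : ℤ) + 2 ^ 10) * 2 ^ 40⟩⟩ := by
          constructor
          · have := MI.mem_ofFrac SD 1 (q := 2) (by norm_num)
            simp only [halfAt]
            convert this using 1; simp
          · simpa using hG
        have hDen := MC.mem_mul SD_pos hρ hDγ
        have hTlS2 : Tl.S = 2 ^ PL.sb := by rw [hTlS]; exact SD_eq_PL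
        have hgm := mem_kernelBox hTl hTlS2 hg (hTlS ▸ hG) hγ0 hγT
        rw [hTlS] at hgm
        obtain ⟨hw0, hbd⟩ := weightBound_sound h hgm hDen
        exact (abs_term_le y γ hw0).trans hbd
    · simp at h
  · simp at h

/-! ### Ordering of the brackets -/

/-- The ordering check, read off. [folklore] -/
lemma orderOk_sound {j : ℕ} (h : orderOk D j = true) :
    8 * 2 ^ CL + 2 ^ 10 ≤ loCtr D j ∧ loCtr D j + 2 ^ 10 < T0N * 2 ^ CL ∧
      (j + 1 < NZ D → loCtr D j + 2 ^ 11 < loCtr D (j + 1)) :=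
  of_decide_eq_true h

/-- The nesting check, read off. [folklore] -/
lemma nestOk_sound {j : ℕ} (h : nestOk D j = true) (hj : isHiB D j = true) :
    ((loCtr D j : ℤ) - 2 ^ 10) * 2 ^ (CB D - CL) ≤ (hiCtr D j : ℤ) - 16 ∧
      (hiCtr D j : ℤ) + 16 ≤ ((loCtr D j : ℤ) + 2 ^ 10) * 2 ^ (CB D - CL) := by
  unfold nestOk at h
  rw [hj] at h
  simpa using h

/-- Soundness of `checkOrder`. [folklore] -/
lemma checkOrder_sound (h : checkOrder D = true) : ∀ j < NZ D, orderOk D j = true ∧ nestOk D j = true := by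
  intro j hj
  unfold checkOrder at h
  rw [List.all_eq_true] at h
  have := h j (List.mem_range.2 hj)
  simpa [Bool.and_eq_true] using this

/-- The light bracket in `ℝ`: `8 ≤ t - r`, `t + r < T₀`, and separation from the next. [folklore] -/
lemma light_bracket {j : ℕ} (h : orderOk D j = true) :
    8 ≤ tL D j - radL ∧ tL D j + radL < T0N ∧ (j + 1 < NZ D → tL D j + radL < tL D (j + 1) - radL) := by
  obtain ⟨h1, h2, h3⟩ := orderOk_sound h
  have hA : (0 : ℝ) < 2 ^ CL := pow_pos (by norm_num) _
  have h1r : (8 : ℝ) * 2 ^ CL + 2 ^ 10 ≤ loCtr D j := by exact_mod_cast h1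
  have h2r : (loCtr D j : ℝ) + 2 ^ 10 < T0N * 2 ^ CL := by exact_mod_cast h2
  refine ⟨?_, ?_, fun hj1 ↦ ?_⟩
  · unfold tL radL; rw [← sub_div, le_div_iff₀ hA]; linarith
  · unfold tL radL; rw [← add_div, div_lt_iff₀ hA]; linarith
  · have h3r : (loCtr D j : ℝ) + 2 ^ 11 < loCtr D (j + 1) := by exact_mod_cast h3 hj1
    unfold tL radL; rw [← add_div, ← sub_div, div_lt_div_iff_of_pos_right hA]
    have : (2 : ℝ) ^ 11 = 2 ^ 10 + 2 ^ 10 := by norm_num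
    linarith

/-- The hi bracket of a heavy zero inside its light bracket, and the integer bounds needed by
`hiCheck_sound`. [folklore] -/
lemma hi_bracket {j : ℕ} (ho : orderOk D j = true) (hn : nestOk D j = true) (hj : isHiB D j = true) :
    tL D j - radL ≤ tH D j - radH D ∧ tH D j + radH D ≤ tL D j + radL ∧
      8 * 2 ^ CB D + 16 ≤ hiCtr D j ∧ hiCtr D j + 16 < T0N * 2 ^ CB D := by
  obtain ⟨h1, h2, -⟩ := orderOk_sound ho
  obtain ⟨n1, n2⟩ := nestOk_sound hn hj
  obtain ⟨Q, hQ⟩ : ∃ Q : ℕ, 2 ^ CL = Q := ⟨_, rfl⟩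
  obtain ⟨P, hP⟩ : ∃ P : ℕ, 2 ^ (CB D - CL) = P := ⟨_, rfl⟩
  have hle : CL ≤ CB D := le_trans (by rw [CL_eq]; norm_num) le_CB
  have hCB : 2 ^ CB D = Q * P := by
    rw [← hQ, ← hP, ← pow_add, Nat.add_sub_cancel' hle]
  rw [hQ] at h1 h2
  have hPz : (2 : ℤ) ^ (CB D - CL) = P := by exact_mod_cast hP
  rw [hPz] at n1 n2
  have hP0 : (0 : ℤ) < P := by rw [← hPz]; positivity
  have h1z : (8 : ℤ) * Q + 2 ^ 10 ≤ loCtr D j := by exact_mod_cast h1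
  have h2z : (loCtr D j : ℤ) + 2 ^ 10 < T0N * Q := by exact_mod_cast h2
  -- integer bounds
  have i1z : (8 : ℤ) * (Q * P) + 16 ≤ hiCtr D j := by
    have : (8 : ℤ) * Q * P ≤ ((loCtr D j : ℤ) - 2 ^ 10) * P :=
      mul_le_mul_of_nonneg_right (by linarith) hP0.le
    linarith
  have i2z : (hiCtr D j : ℤ) + 16 < T0N * (Q * P) := by
    have : ((loCtr D j : ℤ) + 2 ^ 10) * P < (T0N : ℤ) * Q * P := mul_lt_mul_of_pos_right h2z hP0
    linarith
  have i1n : 8 * 2 ^ CB D + 16 ≤ hiCtr D j := by rw [hCB]; exact_mod_cast i1z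
  have i2n : hiCtr D j + 16 < T0N * 2 ^ CB D := by rw [hCB]; exact_mod_cast i2z
  -- real containment
  have hQr : (2 : ℝ) ^ CL = Q := by exact_mod_cast hQ
  have hCBr : (2 : ℝ) ^ CB D = (Q : ℝ) * P := by exact_mod_cast hCB
  have hQ0 : (0 : ℝ) < Q := by rw [← hQr]; positivity
  have hPr : (0 : ℝ) < P := by exact_mod_cast hP0
  have n1r : ((loCtr D j : ℝ) - 2 ^ 10) * P ≤ (hiCtr D j : ℝ) - 16 := by exact_mod_cast n1
  have n2r : (hiCtr D j : ℝ) + 16 ≤ ((loCtr D j : ℝ) + 2 ^ 10) * P := by exact_mod_cast n2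
  refine ⟨?_, ?_, i1n, i2n⟩
  · unfold tL radL tH radH
    rw [← sub_div, ← sub_div, hQr, hCBr, div_le_div_iff₀ hQ0 (by positivity)]
    have key := mul_le_mul_of_nonneg_left n1r hQ0.le
    clear hQ hP hCB hPz h1 h2 n1 n2 i1z i2z i1n i2n h1z h2z hQr hCBr hle n2r
    have e1 : ((loCtr D j : ℝ) - 2 ^ 10) * ((Q : ℝ) * P) = (Q : ℝ) * (((loCtr D j : ℝ) - 2 ^ 10) * P) := by ring
    have e2 : ((hiCtr D j : ℝ) - 16) * (Q : ℝ) = (Q : ℝ) * ((hiCtr D j : ℝ) - 16) := by ring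
    rw [e1, e2]; exact key
  · unfold tL radL tH radH
    rw [← add_div, ← add_div, hQr, hCBr, div_le_div_iff₀ (by positivity) hQ0]
    have key := mul_le_mul_of_nonneg_left n2r hQ0.le
    clear hQ hP hCB hPz h1 h2 n1 n2 i1z i2z i1n i2n h1z h2z hQr hCBr hle n1r
    have e1 : ((hiCtr D j : ℝ) + 16) * (Q : ℝ) = (Q : ℝ) * ((hiCtr D j : ℝ) + 16) := by ring
    have e2 : ((loCtr D j : ℝ) + 2 ^ 10) * ((Q : ℝ) * P) = (Q : ℝ) * (((loCtr D j : ℝ) + 2 ^ 10) * P) := by ring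
    rw [e1, e2]; exact key

/-- The chosen bracket of zero `j` lies in its light bracket and is well ordered. [folklore] -/
lemma bracket_sub {j : ℕ} (ho : orderOk D j = true) (hn : nestOk D j = true) :
    tL D j - radL ≤ aBr D j ∧ bBr D j ≤ tL D j + radL ∧ aBr D j < bBr D j := by
  unfold aBr bBr
  cases hj : isHiB D j
  · simp only [Bool.false_eq_true, ↓reduceIte]
    exact ⟨le_rfl, le_rfl, by linarith [radL_pos]⟩
  · simp only [↓reduceIte]
    obtain ⟨h1, h2, -, -⟩ := hi_bracket ho hn hj
    exact ⟨h1, h2, by linarith [radH_pos (D := D)]⟩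

/-! ### Index lists -/

/-- Elements of `hiIdx` are heavy zeros below `NZ`. [folklore] -/
lemma hiIdx_spec {r : ℕ} (hr : r < NH D) : (hiIdx D).getD r 0 < NZ D ∧ isHiB D ((hiIdx D).getD r 0) = true := by
  have hr' : r < (hiIdx D).length := hr
  set j := (hiIdx D).getD r 0 with hj
  have hmem : j ∈ hiIdx D := by rw [hj, List.getD_eq_getElem _ _ hr']; exact List.getElem_mem hr'
  have hmem' : j ∈ (List.range (NZ D)).filter fun j ↦ isHiB D j := hmem
  rw [List.mem_filter, List.mem_range] at hmem'
  exact ⟨hmem'.1, hmem'.2⟩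

/-- Elements of `loIdx` are light zeros below `NZ`. [folklore] -/
lemma loIdx_spec {r : ℕ} (hr : r < NL D) : (loIdx D).getD r 0 < NZ D ∧ isHiB D ((loIdx D).getD r 0) = false := by
  have hr' : r < (loIdx D).length := hr
  set j := (loIdx D).getD r 0 with hj
  have hmem : j ∈ loIdx D := by rw [hj, List.getD_eq_getElem _ _ hr']; exact List.getElem_mem hr'
  have hmem' : j ∈ (List.range (NZ D)).filter fun j ↦ !isHiB D j := hmem
  rw [List.mem_filter, List.mem_range] at hmem'
  exact ⟨hmem'.1, by simpa using hmem'.2⟩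

/-- Every heavy zero occurs in `hiIdx`. [folklore] -/
lemma exists_hiIdx {j : ℕ} (hj : j < NZ D) (hh : isHiB D j = true) : ∃ r < NH D, (hiIdx D).getD r 0 = j := by
  have hmem : j ∈ hiIdx D := by
    unfold hiIdx; rw [List.mem_filter, List.mem_range]; exact ⟨hj, hh⟩
  obtain ⟨r, hr, hrj⟩ := List.mem_iff_getElem.1 hmem
  exact ⟨r, hr, by rw [List.getD_eq_getElem _ _ hr]; exact hrj⟩

/-- Every light zero occurs in `loIdx`. [folklore] -/
lemma exists_loIdx {j : ℕ} (hj : j < NZ D) (hh : isHiB D j = false) : ∃ r < NL D, (loIdx D).getD r 0 = j := by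
  have hmem : j ∈ loIdx D := by
    unfold loIdx; rw [List.mem_filter, List.mem_range]; exact ⟨hj, by simp [hh]⟩
  obtain ⟨r, hr, hrj⟩ := List.mem_iff_getElem.1 hmem
  exact ⟨r, hr, by rw [List.getD_eq_getElem _ _ hr]; exact hrj⟩

/-- `hiIdx` has no duplicates. [folklore] -/
lemma hiIdx_nodup : (hiIdx D).Nodup := (List.nodup_range).filter _

/-- `loIdx` has no duplicates. [folklore] -/
lemma loIdx_nodup : (loIdx D).Nodup := (List.nodup_range).filter _

/-! ### Blocks -/

/-- Soundness of `hiSums`. [folklore] -/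
theorem hiSums_sound {Th Tl : Tables} (hTh : Th.Valid) (hThS : Th.S = S D) (hTl : Tl.Valid)
    (hTlS : Tl.S = SD) (hord : ∀ j < NZ D, orderOk D j = true ∧ nestOk D j = true) (νT k : ℕ) :
    ∀ (i : ℕ) {sl sh : ℤ}, hiSums D Th Tl νT k i = some (sl, sh) →
      (∀ i' < i, k * CHh D + i' < NH D →
        hardyZ (tH D ((hiIdx D).getD (k * CHh D + i') 0) - radH D) *
          hardyZ (tH D ((hiIdx D).getD (k * CHh D + i') 0) + radH D) < 0) ∧
      ∀ γ : ℕ → ℝ, (∀ i' < i, k * CHh D + i' < NH D → γ (k * CHh D + i') ∈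
          Set.Icc (tH D ((hiIdx D).getD (k * CHh D + i') 0) - radH D)
            (tH D ((hiIdx D).getD (k * CHh D + i') 0) + radH D)) →
        (sl : ℝ) ≤ (∑ i' ∈ Finset.range i, if k * CHh D + i' < NH D then term D.yPlus (γ (k * CHh D + i')) else 0) * Th.S ∧
          (∑ i' ∈ Finset.range i, if k * CHh D + i' < NH D then term D.yMinus (γ (k * CHh D + i')) else 0) * Th.S ≤ sh
  | 0, sl, sh, h => by
    simp only [hiSums, Option.some.injEq, Prod.mk.injEq] at h
    obtain ⟨rfl, rfl⟩ := h
    refine ⟨fun i' hi' ↦ absurd hi' (Nat.not_lt_zero _), fun γ _ ↦ ?_⟩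
    simp only [Finset.sum_range_zero, zero_mul, Int.cast_zero, le_refl, and_self]
  | i + 1, sl, sh, h => by
    simp only [hiSums] at h
    split at h
    · simp at h
    · rename_i sl0 sh0 hprev
      obtain ⟨ih1, ih2⟩ := hiSums_sound hTh hThS hTl hTlS hord νT k i hprev
      split_ifs at h with hr
      · split at h
        · rename_i vlo vhi hz
          simp only [Option.some.injEq, Prod.mk.injEq] at h
          obtain ⟨rfl, rfl⟩ := h
          set j := (hiIdx D).getD (k * CHh D + i) 0 with hjdef
          obtain ⟨hjN, hjH⟩ := hiIdx_spec (D := D) hr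
          obtain ⟨ho, hn⟩ := hord _ hjN
          obtain ⟨-, -, hc8, hcT⟩ := hi_bracket ho hn hjH
          obtain ⟨hsign, hbd⟩ := hiCheck_sound hTh hThS hTl hTlS hc8 hcT hz
          refine ⟨fun i' hi' hr' ↦ ?_, fun γ hγ ↦ ?_⟩
          · rcases Nat.lt_succ_iff_lt_or_eq.1 hi' with hlt | heq
            · exact ih1 i' hlt hr'
            · subst heq; exact hsign
          · obtain ⟨hs1, hs2⟩ := ih2 γ fun i' hi' ↦ hγ i' (Nat.lt_succ_of_lt hi')
            have hγi := hγ i (Nat.lt_succ_self i) hr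
            obtain ⟨hb1, hb2⟩ := hbd (γ (k * CHh D + i)) hγi
            rw [Finset.sum_range_succ, Finset.sum_range_succ, if_pos hr, if_pos hr, add_mul, add_mul]
            push_cast
            constructor <;> linarith
        · simp at h
      · simp only [Option.some.injEq, Prod.mk.injEq] at h
        obtain ⟨rfl, rfl⟩ := h
        refine ⟨fun i' hi' hr' ↦ ?_, fun γ hγ ↦ ?_⟩
        · rcases Nat.lt_succ_iff_lt_or_eq.1 hi' with hlt | heq
          · exact ih1 i' hlt hr'
          · subst heq; exact absurd hr' hr
        · obtain ⟨hs1, hs2⟩ := ih2 γ fun i' hi' ↦ hγ i' (Nat.lt_succ_of_lt hi')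
          rw [Finset.sum_range_succ, Finset.sum_range_succ, if_neg hr, if_neg hr, add_zero, add_zero]
          exact ⟨hs1, hs2⟩

/-- What a passed hi block check gives. [folklore] -/
theorem checkHiChunk_sound (hord : ∀ j < NZ D, orderOk D j = true ∧ nestOk D j = true)
    {pp : ℕ × ℕ × ℕ} {b : ℤ × ℤ} {k : ℕ} (h : checkHiChunk D pp b k = true) :
    (∀ i < CHh D, k * CHh D + i < NH D →
        hardyZ (tH D ((hiIdx D).getD (k * CHh D + i) 0) - radH D) *
          hardyZ (tH D ((hiIdx D).getD (k * CHh D + i) 0) + radH D) < 0) ∧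
    ∀ γ : ℕ → ℝ, (∀ i < CHh D, k * CHh D + i < NH D → γ (k * CHh D + i) ∈
        Set.Icc (tH D ((hiIdx D).getD (k * CHh D + i) 0) - radH D)
          (tH D ((hiIdx D).getD (k * CHh D + i) 0) + radH D)) →
      (b.1 : ℝ) / 2 ^ 60 ≤ ∑ i ∈ Finset.range (CHh D),
          (if k * CHh D + i < NH D then term D.yPlus (γ (k * CHh D + i)) else 0) ∧
        ∑ i ∈ Finset.range (CHh D),
          (if k * CHh D + i < NH D then term D.yMinus (γ (k * CHh D + i)) else 0) ≤ (b.2 : ℝ) / 2 ^ 60 := by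
  unfold checkHiChunk at h
  generalize hH : tabHi D pp = oh at h
  generalize hL : tabLo = ol at h
  rcases oh with _ | Th
  · simp only [Option.bind_none, Option.getD_none] at h
    exact absurd h Bool.false_ne_true
  rcases ol with _ | Tl
  · simp only [Option.bind_some, Option.map_none, Option.getD_none] at h
    exact absurd h Bool.false_ne_true
  simp only [Option.bind_some, Option.map_some, Option.getD_some] at h
  have hTh := tabHi_valid hH
  have hThS := tabHi_S hH
  have hTl := tabLo_valid hL
  have hTlS := tabLo_S hL
  unfold checkHiChunkWith at h
  generalize hcs : hiSums D Th Tl pp.2.2 k (CHh D) = r at h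
  rcases r with _ | ⟨sl, sh⟩
  · simp [boundsOk] at h
  · simp only [boundsOk, decide_eq_true_eq] at h
    obtain ⟨h1, h2⟩ := hiSums_sound hTh hThS hTl hTlS hord pp.2.2 k (CHh D) hcs
    refine ⟨h1, fun γ hγ ↦ ?_⟩
    obtain ⟨hs1, hs2⟩ := h2 γ hγ
    rw [hThS] at hs1 hs2
    have e1 : ((b.1 : ℤ) : ℝ) * 2 ^ (SB D - 60) ≤ sl := by
      have := Int.cast_le (R := ℝ) |>.2 h.1
      push_cast at this; exact this
    have e2 : (sh : ℝ) ≤ ((b.2 : ℤ) : ℝ) * 2 ^ (SB D - 60) := by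
      have := Int.cast_le (R := ℝ) |>.2 h.2
      push_cast at this; exact this
    rw [S_real''] at hs1 hs2
    have hp : (0 : ℝ) < 2 ^ (SB D - 60) := pow_pos (by norm_num) _
    have h60 : (0 : ℝ) < 2 ^ 60 := pow_pos (by norm_num) _
    constructor
    · rw [div_le_iff₀ h60]
      have key : ((b.1 : ℤ) : ℝ) * 2 ^ (SB D - 60) ≤
          (∑ i ∈ Finset.range (CHh D), (if k * CHh D + i < NH D then term D.yPlus (γ (k * CHh D + i)) else 0)) *
            2 ^ 60 * 2 ^ (SB D - 60) := by linarith
      exact le_of_mul_le_mul_right key hp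
    · rw [le_div_iff₀ h60]
      have key : (∑ i ∈ Finset.range (CHh D), (if k * CHh D + i < NH D then term D.yMinus (γ (k * CHh D + i)) else 0)) *
          2 ^ 60 * 2 ^ (SB D - 60) ≤ ((b.2 : ℤ) : ℝ) * 2 ^ (SB D - 60) := by linarith
      exact le_of_mul_le_mul_right key hp

/-- Soundness of `loSums`. [folklore] -/
theorem loSums_sound {Tl : Tables} (hTl : Tl.Valid) (hTlS : Tl.S = SD)
    (hord : ∀ j < NZ D, orderOk D j = true ∧ nestOk D j = true) (k : ℕ) :
    ∀ (i : ℕ) {w : ℕ}, loSums D Tl k i = some w →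
      (∀ i' < i, k * CHL + i' < NL D →
        hardyZ (tL D ((loIdx D).getD (k * CHL + i') 0) - radL) *
          hardyZ (tL D ((loIdx D).getD (k * CHL + i') 0) + radL) < 0) ∧
      ∀ (y : ℝ) (γ : ℕ → ℝ), (∀ i' < i, k * CHL + i' < NL D → γ (k * CHL + i') ∈
          Set.Icc (tL D ((loIdx D).getD (k * CHL + i') 0) - radL)
            (tL D ((loIdx D).getD (k * CHL + i') 0) + radL)) →
        ∑ i' ∈ Finset.range i, (if k * CHL + i' < NL D then |term y (γ (k * CHL + i'))| else 0) ≤ (w : ℝ) / 2 ^ 60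
  | 0, w, h => by
    simp only [loSums, Option.some.injEq] at h
    subst h
    refine ⟨fun i' hi' ↦ absurd hi' (Nat.not_lt_zero _), fun y γ _ ↦ ?_⟩
    simp
  | i + 1, w, h => by
    simp only [loSums] at h
    split at h
    · simp at h
    · rename_i w0 hprev
      obtain ⟨ih1, ih2⟩ := loSums_sound hTl hTlS hord k i hprev
      split_ifs at h with hr
      · split at h
        · rename_i wB hz
          simp only [Option.some.injEq] at h
          subst h
          set j := (loIdx D).getD (k * CHL + i) 0 with hjdef
          obtain ⟨hjN, hjL⟩ := loIdx_spec (D := D) hr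
          obtain ⟨ho, -⟩ := hord _ hjN
          obtain ⟨hc8, hcT, -⟩ := orderOk_sound ho
          obtain ⟨hsign, hbd⟩ := lightCheck_sound hTl hTlS hc8 hcT hz
          refine ⟨fun i' hi' hr' ↦ ?_, fun y γ hγ ↦ ?_⟩
          · rcases Nat.lt_succ_iff_lt_or_eq.1 hi' with hlt | heq
            · exact ih1 i' hlt hr'
            · subst heq; exact hsign
          · have hs := ih2 y γ fun i' hi' ↦ hγ i' (Nat.lt_succ_of_lt hi')
            have hγi := hγ i (Nat.lt_succ_self i) hr
            have hb := hbd (γ (k * CHL + i)) hγi y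
            rw [Finset.sum_range_succ, if_pos hr]
            push_cast
            rw [add_div]
            linarith
        · simp at h
      · simp only [Option.some.injEq] at h
        subst h
        refine ⟨fun i' hi' hr' ↦ ?_, fun y γ hγ ↦ ?_⟩
        · rcases Nat.lt_succ_iff_lt_or_eq.1 hi' with hlt | heq
          · exact ih1 i' hlt hr'
          · subst heq; exact absurd hr' hr
        · have hs := ih2 y γ fun i' hi' ↦ hγ i' (Nat.lt_succ_of_lt hi')
          rw [Finset.sum_range_succ, if_neg hr, add_zero]
          exact hs

/-- What a passed light block check gives. [folklore] -/
theorem checkLightChunk_sound (hord : ∀ j < NZ D, orderOk D j = true ∧ nestOk D j = true)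
    {N w : ℕ} {k : ℕ} (h : checkLightChunk D N w k = true) :
    (∀ i < CHL, k * CHL + i < NL D →
        hardyZ (tL D ((loIdx D).getD (k * CHL + i) 0) - radL) *
          hardyZ (tL D ((loIdx D).getD (k * CHL + i) 0) + radL) < 0) ∧
    ∀ (y : ℝ) (γ : ℕ → ℝ), (∀ i < CHL, k * CHL + i < NL D → γ (k * CHL + i) ∈
        Set.Icc (tL D ((loIdx D).getD (k * CHL + i) 0) - radL)
          (tL D ((loIdx D).getD (k * CHL + i) 0) + radL)) →
      ∑ i ∈ Finset.range CHL, (if k * CHL + i < NL D then |term y (γ (k * CHL + i))| else 0) ≤ (w : ℝ) / 2 ^ 60 := by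
  unfold checkLightChunk at h
  generalize hL : tabLoN N = ol at h
  rcases ol with _ | Tl
  · simp only [Option.map_none, Option.getD_none] at h
    exact absurd h Bool.false_ne_true
  simp only [Option.map_some, Option.getD_some] at h
  have hTl := tabLoN_valid hL
  have hTlS := tabLoN_S hL
  unfold checkLightChunkWith at h
  split at h
  · simp at h
  · rename_i s hs
    have hsw : s ≤ w := of_decide_eq_true h
    obtain ⟨h1, h2⟩ := loSums_sound hTl hTlS hord k CHL hs
    refine ⟨h1, fun y γ hγ ↦ (h2 y γ hγ).trans ?_⟩
    exact div_le_div_of_nonneg_right (by exact_mod_cast hsw) (by positivity)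

/-! ### The top edge -/

/-- Soundness of `labelOk` at any scale. [folklore] -/
lemma labelOk_sound' {sc : ℕ} {d : Fin 4} {Z : MC} (h : Mertens.labelOk d Z = true) {z : ℂ} (hz : MC.mem sc z Z) :
    0 < (qrot d * z).re := by
  fin_cases d
  · have hlt : 0 < Z.re.lo := of_decide_eq_true h
    have := MI.pos_of_lo_pos hz.1 hlt
    simpa [qrot] using this
  · have hlt : 0 < Z.im.lo := of_decide_eq_true h
    have := MI.pos_of_lo_pos hz.2 hlt
    simpa [qrot] using this
  · have hlt : Z.re.hi < 0 := of_decide_eq_true h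
    have := MI.neg_of_hi_neg hz.1 hlt
    simp [qrot]; linarith
  · have hlt : Z.im.hi < 0 := of_decide_eq_true h
    have := MI.neg_of_hi_neg hz.2 hlt
    simp [qrot]; linarith

/-- [folklore] -/
lemma ST5_pos : 0 < ST5 := by unfold ST5; positivity

/-- `2¹² ∣ ST5`. [folklore] -/
lemma ST5_div : (ST5 / 4096 : ℕ) * 4096 = ST5 := by unfold ST5; norm_num

/-- `ST5 = 2^PT.sb`. [folklore] -/
lemma ST5_eq_PT : ST5 = 2 ^ PT.sb := rfl

attribute [irreducible] ST5

/-- Membership of `x + iT₀` in `topBox x₀ x₁` for `x₀/2¹² ≤ x ≤ x₁/2¹²`. [folklore] -/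
lemma mem_topBox {x0 x1 : ℕ} {x : ℝ} (hx : x ∈ Set.Icc ((x0 : ℝ) / 4096) ((x1 : ℝ) / 4096)) :
    MC.mem ST5 ((x : ℂ) + (T0N : ℝ) * I) (topBox x0 x1) := by
  have hq : ((ST5 / 4096 : ℕ) : ℝ) * 4096 = ST5 := by
    rw [show (4096 : ℝ) = ((4096 : ℕ) : ℝ) by norm_num, ← Nat.cast_mul, ST5_div]
  constructor
  · simp only [topBox, Complex.add_re, Complex.ofReal_re, Complex.mul_re, Complex.I_re,
      Complex.I_im, Complex.ofReal_im, mul_zero, zero_mul, sub_zero, add_zero]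
    obtain ⟨h1, h2⟩ := hx
    rw [div_le_iff₀ (by norm_num)] at h1
    rw [le_div_iff₀ (by norm_num)] at h2
    have hp : (0 : ℝ) ≤ ((ST5 / 4096 : ℕ) : ℝ) := by positivity
    constructor
    · simp only [Int.cast_mul, Int.cast_natCast]
      calc (x0 : ℝ) * ((ST5 / 4096 : ℕ) : ℝ) ≤ x * 4096 * ((ST5 / 4096 : ℕ) : ℝ) :=
            mul_le_mul_of_nonneg_right h1 hp
        _ = x * ST5 := by rw [← hq]; ring
    · simp only [Int.cast_mul, Int.cast_natCast]
      calc x * (ST5 : ℝ) = x * 4096 * ((ST5 / 4096 : ℕ) : ℝ) := by rw [← hq]; ring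
        _ ≤ (x1 : ℝ) * ((ST5 / 4096 : ℕ) : ℝ) := mul_le_mul_of_nonneg_right h2 hp
  · simp only [topBox, Complex.add_im, Complex.ofReal_im, Complex.mul_im, Complex.I_re,
      Complex.I_im, Complex.ofReal_re, mul_zero, mul_one, zero_add, add_zero]
    exact_mod_cast MI.mem_ofInt ST5 (T0N : ℤ)

/-- Soundness of `checkPieces`: a valid `HPieces` certificate for `ζ` at height `T₀ = 5000`. [folklore] -/
theorem hpieces_of_checkPieces {T : Tables} (hT : T.Valid) (hTS : T.S = ST5) :
    ∀ (x0 : ℕ) (ps : List (ℕ × Fin 4)), checkPieces T x0 ps = true →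
      HPieces riemannZeta T0N ((x0 : ℝ) / 4096) (Mertens.toRealPieces ps)
  | x0, [], _ => trivial
  | x0, (x1, d) :: ps, h => by
    simp only [checkPieces, Bool.and_eq_true, decide_eq_true_eq] at h
    obtain ⟨⟨h01, hmid⟩, htail⟩ := h
    simp only [Mertens.toRealPieces]
    refine ⟨by exact_mod_cast (div_le_div_of_nonneg_right (by exact_mod_cast h01) (by norm_num)), ?_,
      hpieces_of_checkPieces hT hTS x1 ps htail⟩
    intro x hx
    split at hmid
    · simp at hmid
    · rename_i Z hZ
      have hs : MC.mem T.S ((x : ℂ) + (T0N : ℝ) * I) (topBox x0 x1) := hTS ▸ mem_topBox hx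
      have hs1 : (x : ℂ) + (T0N : ℝ) * I ≠ 1 := fun h ↦ by
        have := congrArg Complex.im h
        simp [T0N_real] at this
      have hm := mem_zetaBoxFast hT hs hs1 hZ
      rw [hTS] at hm
      exact labelOk_sound' hmid hm

/-- Soundness of `checkStirling`. [folklore] -/
theorem stirling_of_checkStirling {T : Tables} (hT : T.Valid) (hTS : T.S = ST5) {n : ℕ} {turns : ℤ}
    (h : checkStirling T n turns = true) :
    |((T0N : ℝ) / 2 * Real.log (T0N / (2 * Real.pi)) - T0N / 2 - Real.pi / 8) / Real.pi + 1 -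
        (turns : ℝ) / 2 - (n : ℕ)| + 2 * stirlingVertRate (1 / 4) / (Real.pi * T0N) ≤ 1 / 2 := by
  have hpi : MI.mem ST5 Real.pi T.piI := hTS ▸ hT.mem_pi
  have hSr : (0 : ℝ) < ST5 := by exact_mod_cast ST5_pos
  unfold checkStirling at h
  simp only at h
  split at h
  · rename_i lT l2 q hlT hl2 hq
    split at h
    · rename_i l3 lq hl3 hlq
      split at h
      · simp at h
      · rename_i Mpi hMpi
        split at h
        · simp at h
        · rename_i R hR
          have hdec : 2 * ((((Mpi.add (MI.ofInt ST5 1)).sub (MI.ofFrac ST5 turns 2)).sub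
              (MI.ofInt ST5 n)).absHi + R.hi) ≤ (ST5 : ℤ) := of_decide_eq_true h
          have hlogT := MI.mem_logNat ST5_pos hlT
          have hlog2 := MI.mem_logTwo ST5_pos hl2
          have hlog3 := MI.mem_logNat ST5_pos hl3
          have h3pi : MI.mem ST5 ((3 : ℝ) / Real.pi) q := by
            have := MI.mem_divPos ST5_pos hq (MI.mem_ofInt ST5 3) hpi; simpa using this
          have hx : MI.mem ST5 (1 - 3 / Real.pi) ((MI.ofInt ST5 1).sub q) := by
            have := MI.mem_sub (MI.mem_ofInt ST5 1) h3pi; simpa using this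
          have hlq' := MI.mem_logOneSub ST5_pos hlq hx
          have hpi0 : 0 < Real.pi := Real.pi_pos
          have elq : Real.log (1 - (1 - 3 / Real.pi)) = Real.log 3 - Real.log Real.pi := by
            rw [show (1 : ℝ) - (1 - 3 / Real.pi) = 3 / Real.pi by ring,
              Real.log_div (by norm_num) hpi0.ne']
          rw [elq] at hlq'
          have hlpi : MI.mem ST5 (Real.log Real.pi) (l3.sub lq) := by
            have := MI.mem_sub hlog3 hlq'
            convert this using 1; push_cast; ring
          have hL : MI.mem ST5 (Real.log (T0N / (2 * Real.pi))) ((lT.sub l2).sub (l3.sub lq)) := by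
            have := MI.mem_sub (MI.mem_sub hlogT hlog2) hlpi
            convert this using 1
            rw [Real.log_div (by rw [T0N_real]; norm_num) (by positivity),
              Real.log_mul (by norm_num) hpi0.ne']
            ring
          have hT2 : MI.mem ST5 ((T0N : ℝ) / 2) (MI.ofFrac ST5 T0N 2) := by
            have := MI.mem_ofFrac ST5 (T0N : ℤ) (q := 2) (by norm_num)
            simpa using this
          set Mv : ℝ := (T0N : ℝ) / 2 * Real.log (T0N / (2 * Real.pi)) - T0N / 2 -
            Real.pi / 8 with hMv
          have hM : MI.mem ST5 Mv (((MI.mul ST5 ((lT.sub l2).sub (l3.sub lq)) (MI.ofFrac ST5 T0N 2)).sub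
              (MI.ofFrac ST5 T0N 2)).sub (T.piI.divNat 8)) := by
            have := MI.mem_sub (MI.mem_sub (MI.mem_mul ST5_pos hL hT2) hT2)
              (MI.mem_divNat hpi (n := 8) (by norm_num))
            convert this using 1
            rw [hMv]; push_cast; ring
          have hMpi' := MI.mem_divPos ST5_pos hMpi hM hpi
          set Wv : ℝ := Mv / Real.pi + 1 - (turns : ℝ) / 2 - (n : ℕ) with hWv
          have hW : MI.mem ST5 Wv (((Mpi.add (MI.ofInt ST5 1)).sub (MI.ofFrac ST5 turns 2)).sub
              (MI.ofInt ST5 n)) := by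
            have := MI.mem_sub (MI.mem_sub (MI.mem_add hMpi' (MI.mem_ofInt ST5 1))
              (MI.mem_ofFrac ST5 turns (q := 2) (by norm_num))) (MI.mem_ofInt ST5 n)
            convert this using 1
            rw [hWv]; push_cast; ring
          have hK : MI.mem ST5 (stirlingVertRate (1 / 4))
              (((MI.ofFrac ST5 1 6).add (MI.ofFrac ST5 5 32)).add (T.piI.divNat 12)) := by
            have := MI.mem_add (MI.mem_add (MI.mem_ofFrac ST5 1 (q := 6) (by norm_num))
              (MI.mem_ofFrac ST5 5 (q := 32) (by norm_num))) (MI.mem_divNat hpi (n := 12) (by norm_num))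
            convert this using 1
            unfold stirlingVertRate; push_cast; ring
          have hRv : MI.mem ST5 (2 * stirlingVertRate (1 / 4) / (Real.pi * T0N)) R := by
            have := MI.mem_divPos ST5_pos hR (MI.mem_mulInt hK 2)
              (MI.mem_mul ST5_pos hpi (MI.mem_ofInt ST5 (T0N : ℤ)))
            convert this using 1; push_cast; ring
          have h1 := MI.abs_le_absHi hW
          have h2 := hRv.2
          have hdec' : (2 : ℝ) * ((((Mpi.add (MI.ofInt ST5 1)).sub (MI.ofFrac ST5 turns 2)).sub
              (MI.ofInt ST5 n)).absHi + R.hi) ≤ ST5 := by exact_mod_cast hdec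
          have : (|Wv| + 2 * stirlingVertRate (1 / 4) / (Real.pi * T0N)) * ST5 ≤ ST5 / 2 := by
            nlinarith
          have := le_of_mul_le_mul_right (by linarith : (|Wv| + 2 * stirlingVertRate (1 / 4) /
            (Real.pi * T0N)) * ST5 ≤ 1 / 2 * ST5) hSr
          simpa [hWv, hMv] using this
    · simp at h
  · simp at h

/-- **The zero count**: `checkTop = true → N(5000) = NZ`. [cite: Titchmarsh1986, Thm. 9.3] -/
theorem zetaZeroCount_of_checkTop (h : checkTop D = true) : zetaZeroCount (T0N : ℝ) = NZ D := by
  unfold checkTop at h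
  generalize hTab : tabTop = o at h
  rcases o with _ | T
  · simp at h
  · simp only [Option.map_some, Option.getD_some] at h
    have hT : T.Valid := tabTop_valid hTab
    have hTS : T.S = ST5 := tabTop_S hTab
    generalize hps : D.pieces = L at h
    rcases L with _ | ⟨⟨x1, d1⟩, ps⟩
    · simp [checkTopWith] at h
    simp only [checkTopWith, Bool.and_eq_true, decide_eq_true_eq] at h
    obtain ⟨⟨⟨hpieces, hlast⟩, hdir⟩, hstir⟩ := h
    have hP := hpieces_of_checkPieces hT hTS 2048 ((x1, d1) :: ps) hpieces
    simp only [Mertens.toRealPieces] at hP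
    have h2048 : ((2048 : ℕ) : ℝ) / 4096 = 1 / 2 := by norm_num
    rw [h2048] at hP
    have hlast' : piecesLast ((x1 : ℝ) / 4096) (Mertens.toRealPieces ps) = 2 := by
      rw [Mertens.piecesLast_toRealPieces, hlast]; norm_num
    have hdir' : piecesLastDir d1 (Mertens.toRealPieces ps) = 0 := by
      rw [Mertens.piecesLastDir_toRealPieces, hdir]
    have hS := stirling_of_checkStirling hT hTS hstir
    rw [← Mertens.piecesTurns_toRealPieces] at hS
    exact zetaZeroCount_eq_of_hpieces_stirling (by rw [T0N_real]; norm_num) hP hlast' hdir' hS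

/-! ### Assembly -/

/-- The final check, read in `ℝ`. [folklore] -/
lemma final_of_checkFinal {bH : ℕ → ℤ × ℤ} {wL : ℕ → ℕ} (h : checkFinal D bH wL = true) :
    (1.6383 : ℝ) < ((sumL D bH : ℝ) - sumW D wL) / 2 ^ 60 ∧ ((sumU D bH : ℝ) + sumW D wL) / 2 ^ 60 < -1.6383 := by
  obtain ⟨h1, h2⟩ := of_decide_eq_true h
  have h1' : (16383 : ℝ) * 2 ^ 60 < 10000 * (sumL D bH - sumW D wL) := by exact_mod_cast h1
  have h2' : (10000 : ℝ) * (sumU D bH + sumW D wL) < -16383 * 2 ^ 60 := by exact_mod_cast h2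
  constructor
  · rw [lt_div_iff₀ (by positivity)]; norm_num; linarith
  · rw [div_lt_iff₀ (by positivity)]; norm_num; linarith

/-- `Σ_{j ∈ (range n).filter p} f j` along the list `(List.range n).filter p`. [folklore] -/
lemma sum_filter_eq_sum_idx (p : ℕ → Bool) (f : ℕ → ℝ) (n : ℕ) :
    ∑ j ∈ (Finset.range n).filter (fun j ↦ p j = true), f j =
      ∑ r ∈ Finset.range ((List.range n).filter p).length, f (((List.range n).filter p).getD r 0) := by
  classical
  set l := (List.range n).filter p with hl
  have hnd : l.Nodup := (List.nodup_range).filter _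
  have hset : (Finset.range n).filter (fun j ↦ p j = true) = l.toFinset := by
    ext j
    simp only [Finset.mem_filter, Finset.mem_range, List.mem_toFinset, hl, List.mem_filter, List.mem_range]
  rw [hset, List.sum_toFinset _ hnd]
  -- `(l.map f).sum = Σ_{r < length} f (l.getD r 0)`
  suffices hh : ∀ l' : List ℕ, (l'.map f).sum = ∑ r ∈ Finset.range l'.length, f (l'.getD r 0) from hh l
  intro l'
  induction l' with
  | nil => simp
  | cons a t ih =>
    rw [List.map_cons, List.sum_cons, List.length_cons, Finset.sum_range_succ', ih]
    simp only [List.getD_cons_succ, List.getD_cons_zero]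
    ring

/-- Extending a sum over `range m` by zeros to `range M ⊇ range m`. [folklore] -/
lemma sum_range_extend {m M : ℕ} (hmM : m ≤ M) (g : ℕ → ℝ) :
    ∑ r ∈ Finset.range M, (if r < m then g r else 0) = ∑ r ∈ Finset.range m, g r := by
  rw [← Finset.sum_range_add_sum_Ico _ hmM]
  have h0 : ∑ r ∈ Finset.Ico m M, (if r < m then g r else 0) = 0 := by
    refine Finset.sum_eq_zero fun r hr ↦ ?_
    rw [Finset.mem_Ico] at hr
    rw [if_neg (by omega)]
  rw [h0, add_zero]
  exact Finset.sum_congr rfl fun r hr ↦ by rw [if_pos (Finset.mem_range.1 hr)]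

/-- **Soundness of the whole certificate.** [cite: BestTrudgian2015, Theorem 1] -/
theorem numerics_of_checks {pT : ℕ → ℕ × ℕ × ℕ} {bH : ℕ → ℤ × ℤ} {pL : ℕ → ℕ} {wL : ℕ → ℕ}
    (hTop : checkTop D = true) (hOrd : checkOrder D = true) (hFin : checkFinal D bH wL = true)
    (hHi : ∀ k < NHC D, checkHiChunk D (pT k) (bH k) k = true)
    (hLo : ∀ k < NLC D, checkLightChunk D (pL k) (wL k) k = true) :
    ∃ T : ℝ, 0 < T ∧
      (∀ ρ : ℂ, riemannZeta ρ = 0 → 0 < ρ.re → ρ.re < 1 → |ρ.im| < T →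
        ρ.re = 1 / 2 ∧ deriv riemannZeta ρ ≠ 0) ∧
      (∃ y : ℝ, (1.6383 : ℝ) <
        (inghamSum (fun t : ℝ => (jurkatPeyerimhoffKernel (t / T) : ℂ)) T y).re) ∧
      (∃ y : ℝ,
        (inghamSum (fun t : ℝ => (jurkatPeyerimhoffKernel (t / T) : ℂ)) T y).re < -1.6383) := by
  classical
  have hord := checkOrder_sound hOrd
  set n := NZ D with hn
  have hT0 : (T0N : ℝ) = 5000 := T0N_real
  have hTpos : (0 : ℝ) < T0N := by rw [hT0]; norm_num
  -- per-zero facts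
  have hsub : ∀ j < n, tL D j - radL ≤ aBr D j ∧ bBr D j ≤ tL D j + radL ∧ aBr D j < bBr D j :=
    fun j hj ↦ bracket_sub (hord j hj).1 (hord j hj).2
  have hlb : ∀ j < n, 8 ≤ tL D j - radL ∧ tL D j + radL < T0N ∧
      (j + 1 < n → tL D j + radL < tL D (j + 1) - radL) := fun j hj ↦ light_bracket (hord j hj).1
  have hsign : ∀ j < n, hardyZ (aBr D j) * hardyZ (bBr D j) < 0 := by
    intro j hj
    unfold aBr bBr
    cases hh : isHiB D j
    · simp only [Bool.false_eq_true, ↓reduceIte]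
      obtain ⟨r, hr, hrj⟩ := exists_loIdx hj hh
      have hk : r / CHL < NLC D := by
        unfold NLC; exact Nat.lt_succ_of_le (Nat.div_le_div_right hr.le)
      have hi : r % CHL < CHL := Nat.mod_lt _ CHL_pos
      have := (checkLightChunk_sound hord (hLo _ hk)).1 (r % CHL) hi (by rwa [Nat.div_add_mod'])
      rwa [Nat.div_add_mod', hrj] at this
    · simp only [↓reduceIte]
      obtain ⟨r, hr, hrj⟩ := exists_hiIdx hj hh
      have hk : r / CHh D < NHC D := by
        unfold NHC; exact Nat.lt_succ_of_le (Nat.div_le_div_right hr.le)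
      have hi : r % CHh D < CHh D := Nat.mod_lt _ CHh_pos
      have := (checkHiChunk_sound hord (hHi _ hk)).1 (r % CHh D) hi (by rwa [Nat.div_add_mod'])
      rwa [Nat.div_add_mod', hrj] at this
  -- the bracketing over `Fin n`
  have hB : ZeroBracketing n (T0N : ℝ) (fun j : Fin n ↦ aBr D j) (fun j : Fin n ↦ bBr D j) := by
    refine ZeroBracketing.of_hardyZ_sign (fun j ↦ (hsub j j.2).2.2.le) (fun j k hjk ↦ ?_)
      (fun j ↦ by linarith [(hlb j j.2).1, (hsub j j.2).1]) (fun j ↦ by linarith [(hlb j j.2).2.1, (hsub j j.2).2.1])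
      (fun j ↦ hsign j j.2)
    have hjk' : (j : ℕ) < k := hjk
    have hsep : ∀ a b : ℕ, a < b → b < n → tL D a + radL < tL D b - radL := by
      intro a b hab hb
      induction b with
      | zero => exact absurd hab (Nat.not_lt_zero _)
      | succ b ih =>
        rcases Nat.lt_succ_iff_lt_or_eq.1 hab with hlt | heq
        · have := ih hlt (by omega)
          have h2 := (hlb b (by omega)).2.2 hb
          linarith [radL_pos]
        · subst heq; exact (hlb a (by omega)).2.2 hb
    have := hsep j k hjk' k.2
    linarith [(hsub j j.2).2.1, (hsub k k.2).1]
  have hN : zetaZeroCount (T0N : ℝ) ≤ n := by rw [zetaZeroCount_of_checkTop hTop]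
  have hNpos : 0 < n ∨ n = 0 := by omega
  -- the sums, split by tier
  set ord : ℕ → ℝ := fun j ↦ if h : j < n then hB.ordinate ⟨j, h⟩ else 0 with hordf
  have hordj : ∀ j (hj : j < n), ord j = hB.ordinate ⟨j, hj⟩ := fun j hj ↦ by
    simp only [hordf]; rw [dif_pos hj]
  have hsum : ∀ y : ℝ, (inghamSum (fun t : ℝ ↦ (jurkatPeyerimhoffKernel (t / T0N) : ℂ)) T0N y).re =
      ∑ j ∈ Finset.range n, term y (ord j) := by
    intro y
    rw [hB.re_inghamSum_eq hTpos.le hN y, Finset.sum_range (fun j ↦ term y (ord j))]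
    refine Finset.sum_congr rfl fun j _ ↦ ?_
    rw [hordj j j.2]; rfl
  have hγmem : ∀ j (hj : j < n), ord j ∈ Set.Icc (aBr D j) (bBr D j) := fun j hj ↦ by
    rw [hordj j hj]; exact ⟨hB.le_ordinate ⟨j, hj⟩, hB.ordinate_le ⟨j, hj⟩⟩
  have hsplit : ∀ y : ℝ, ∑ j ∈ Finset.range n, term y (ord j) =
      ∑ j ∈ (Finset.range n).filter (fun j ↦ isHiB D j = true), term y (ord j) +
        ∑ j ∈ (Finset.range n).filter (fun j ↦ ¬ isHiB D j = true), term y (ord j) :=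
    fun y ↦ (Finset.sum_filter_add_sum_filter_not _ _ _).symm
  have hHiEq : ∀ y : ℝ, ∑ j ∈ (Finset.range n).filter (fun j ↦ isHiB D j = true), term y (ord j) =
      ∑ r ∈ Finset.range (NHC D * CHh D), (if r < NH D then term y (ord ((hiIdx D).getD r 0)) else 0) := by
    intro y
    rw [sum_filter_eq_sum_idx (fun j ↦ isHiB D j) (fun j ↦ term y (ord j))]
    have hle : NH D ≤ NHC D * CHh D := by
      unfold NHC
      have := Nat.lt_mul_div_succ (NH D) (CHh_pos (D := D))
      rw [mul_comm] at this; exact this.le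
    rw [sum_range_extend hle]; rfl
  have hLoEq : ∀ y : ℝ, ∑ j ∈ (Finset.range n).filter (fun j ↦ ¬ isHiB D j = true), term y (ord j) =
      ∑ r ∈ Finset.range (NLC D * CHL), (if r < NL D then term y (ord ((loIdx D).getD r 0)) else 0) := by
    intro y
    have e : (Finset.range n).filter (fun j ↦ ¬ isHiB D j = true) =
        (Finset.range n).filter (fun j ↦ (!isHiB D j) = true) := by
      ext j; simp
    rw [e, sum_filter_eq_sum_idx (fun j ↦ !isHiB D j) (fun j ↦ term y (ord j))]
    have hle : NL D ≤ NLC D * CHL := by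
      unfold NLC
      have := Nat.lt_mul_div_succ (NL D) CHL_pos
      rw [mul_comm] at this; exact this.le
    rw [sum_range_extend hle]; rfl
  -- bounds on the hi part
  have hHiBounds : ∀ k < NHC D,
      ((bH k).1 : ℝ) / 2 ^ 60 ≤ ∑ i ∈ Finset.range (CHh D),
          (if k * CHh D + i < NH D then term D.yPlus (ord ((hiIdx D).getD (k * CHh D + i) 0)) else 0) ∧
      ∑ i ∈ Finset.range (CHh D),
          (if k * CHh D + i < NH D then term D.yMinus (ord ((hiIdx D).getD (k * CHh D + i) 0)) else 0) ≤ ((bH k).2 : ℝ) / 2 ^ 60 := by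
    intro k hk
    exact (checkHiChunk_sound hord (hHi k hk)).2 (fun r ↦ ord ((hiIdx D).getD r 0)) (fun i hi hr ↦ by
      obtain ⟨hjN, hjH⟩ := hiIdx_spec (D := D) hr
      have h1 := hγmem _ hjN
      have ea : aBr D ((hiIdx D).getD (k * CHh D + i) 0) = tH D ((hiIdx D).getD (k * CHh D + i) 0) - radH D := by
        unfold aBr; rw [if_pos hjH]
      have eb : bBr D ((hiIdx D).getD (k * CHh D + i) 0) = tH D ((hiIdx D).getD (k * CHh D + i) 0) + radH D := by
        unfold bBr; rw [if_pos hjH]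
      rw [ea, eb] at h1
      exact h1)
  -- bounds on the light part
  have hLoBounds : ∀ (y : ℝ), ∀ k < NLC D,
      ∑ i ∈ Finset.range CHL, |(if k * CHL + i < NL D then term y (ord ((loIdx D).getD (k * CHL + i) 0)) else 0)| ≤ (wL k : ℝ) / 2 ^ 60 := by
    intro y k hk
    have key := (checkLightChunk_sound hord (hLo k hk)).2 y (fun r ↦ ord ((loIdx D).getD r 0)) (fun i hi hr ↦ by
      obtain ⟨hjN, hjL⟩ := loIdx_spec (D := D) hr
      have h1 := hγmem _ hjN
      have hne : ¬ (isHiB D ((loIdx D).getD (k * CHL + i) 0) = true) := by rw [hjL]; exact Bool.false_ne_true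
      have ea : aBr D ((loIdx D).getD (k * CHL + i) 0) = tL D ((loIdx D).getD (k * CHL + i) 0) - radL := by
        unfold aBr; rw [if_neg hne]
      have eb : bBr D ((loIdx D).getD (k * CHL + i) 0) = tL D ((loIdx D).getD (k * CHL + i) 0) + radL := by
        unfold bBr; rw [if_neg hne]
      rw [ea, eb] at h1
      exact h1)
    refine le_trans (le_of_eq (Finset.sum_congr rfl fun i _ ↦ ?_)) key
    by_cases hr : k * CHL + i < NL D
    · rw [if_pos hr, if_pos hr]
    · rw [if_neg hr, if_neg hr, abs_zero]
  obtain ⟨hFL, hFU⟩ := final_of_checkFinal hFin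
  refine ⟨T0N, hTpos, hB.zero_clause hTpos.le hN, ⟨D.yPlus, ?_⟩, ⟨D.yMinus, ?_⟩⟩
  · rw [hsum, hsplit, hHiEq, hLoEq, Mertens.sum_range_mul, Mertens.sum_range_mul]
    refine hFL.trans_le ?_
    have h1 : ((sumL D bH : ℝ)) / 2 ^ 60 ≤ ∑ k ∈ Finset.range (NHC D), ∑ i ∈ Finset.range (CHh D),
        (if k * CHh D + i < NH D then term D.yPlus (ord ((hiIdx D).getD (k * CHh D + i) 0)) else 0) := by
      unfold sumL; push_cast; rw [Finset.sum_div]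
      exact Finset.sum_le_sum fun k hk ↦ (hHiBounds k (Finset.mem_range.1 hk)).1
    have h2 : -((sumW D wL : ℝ) / 2 ^ 60) ≤ ∑ k ∈ Finset.range (NLC D), ∑ i ∈ Finset.range CHL,
        (if k * CHL + i < NL D then term D.yPlus (ord ((loIdx D).getD (k * CHL + i) 0)) else 0) := by
      unfold sumW; push_cast; rw [Finset.sum_div, ← Finset.sum_neg_distrib]
      refine Finset.sum_le_sum fun k hk ↦ ?_
      have hb := hLoBounds D.yPlus k (Finset.mem_range.1 hk)
      have := Finset.abs_sum_le_sum_abs (fun i ↦ (if k * CHL + i < NL D then term D.yPlus (ord ((loIdx D).getD (k * CHL + i) 0)) else 0))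
        (Finset.range CHL)
      have habs := (abs_le.1 (this.trans hb)).1
      linarith
    have e : ((sumL D bH : ℝ) - sumW D wL) / 2 ^ 60 = (sumL D bH : ℝ) / 2 ^ 60 + -((sumW D wL : ℝ) / 2 ^ 60) := by ring
    rw [e]
    linarith
  · rw [hsum, hsplit, hHiEq, hLoEq, Mertens.sum_range_mul, Mertens.sum_range_mul]
    refine lt_of_le_of_lt ?_ hFU
    have h1 : ∑ k ∈ Finset.range (NHC D), ∑ i ∈ Finset.range (CHh D),
        (if k * CHh D + i < NH D then term D.yMinus (ord ((hiIdx D).getD (k * CHh D + i) 0)) else 0) ≤ (sumU D bH : ℝ) / 2 ^ 60 := by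
      unfold sumU; push_cast; rw [Finset.sum_div]
      exact Finset.sum_le_sum fun k hk ↦ (hHiBounds k (Finset.mem_range.1 hk)).2
    have h2 : ∑ k ∈ Finset.range (NLC D), ∑ i ∈ Finset.range CHL,
        (if k * CHL + i < NL D then term D.yMinus (ord ((loIdx D).getD (k * CHL + i) 0)) else 0) ≤ (sumW D wL : ℝ) / 2 ^ 60 := by
      unfold sumW; push_cast; rw [Finset.sum_div]
      refine Finset.sum_le_sum fun k hk ↦ ?_
      have hb := hLoBounds D.yMinus k (Finset.mem_range.1 hk)
      have := Finset.abs_sum_le_sum_abs (fun i ↦ (if k * CHL + i < NL D then term D.yMinus (ord ((loIdx D).getD (k * CHL + i) 0)) else 0))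
        (Finset.range CHL)
      have habs := (abs_le.1 (this.trans hb)).2
      linarith
    have e : ((sumU D bH : ℝ) + sumW D wL) / 2 ^ 60 = (sumU D bH : ℝ) / 2 ^ 60 + (sumW D wL : ℝ) / 2 ^ 60 := by ring
    rw [e]
    linarith

end Soundness

/-! The checks are evaluated only by `native_decide` (block files); make them opaque to the
elaborator so that stating `checkHiChunk D b k = true` never unfolds the computation. -/
attribute [irreducible] checkHiChunk checkLightChunk checkFinal checkOrder checkTop

end Literature.NumberTheory.LFunctions.ZetaNumerics.MertensBT2
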